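import Mathlib
import Literature.MathematicalPhysics.QuantumFieldTheory.Balaban1983to89.T4CubeShellMMatrix

/-!
# Cube-shell conditioning XII: the PER-FACE LAPLACE BOUND on road (d) — `|Wall_{e_l}(Ψ)| ≤ 2 η'(λ,δ) sup_K|Ψ|` for
every conditional density with the interior-mode property — and THE FIRST PROVED WINDOWED SEED AND DECAY PROFILE for
the road-(d) class `P_M(m₂) ∩ 𝔐_ε ∩ IntMode δ`

Landing edition «CubeShell XII» of the ideation cell `ym-nodeO-ideate` (seat P1, lens «inside Bałaban»; memo
`memos/ROUTE-P1.md` §0y.43, companion 48 `memos/ROUTE-P1-SketchCubeShellXII.lean`), over the landed modules III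
`T4CubePoincare`, IV `T4CubeShellConditional`, VII `T4CubeShellProfile` (seat P8), VIII `T4CubeShellProfileP`, IX
`T4CubeShellGradPartner`, X `T4CubeShellSteinSeed`, XI `T4CubeShellMMatrix` of this directory.  Module X reduced the
windowed decay estimate for a conditioning-closed class to three inputs per exact child triple — (W1) the `ℓ¹`-mass of the
solving direction on the far support (Combes–Thomas, PROVED there), (W2) THE WALL TERM `Wall_w(Φ̃)` of the hard window,
(W3) a perturbative term — and located the obstruction in (W2); module XI typed road (d): on the Z-row sub-class the wall
term splits into `‖w‖₁ ≤ a∕m₂` times the PER-FACE fluxes `Wall_{e_l}(Φ̃)`, and the interior-mode property `IntMode δ`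
(every block-critical point with off-block data in the window lies `δ` inside) is conditioning-closed — leaving ONE rung,
its header's (d3): a per-face flux bound for a density all of whose coordinate-line restrictions have their mode `≥ δ`
away from the face.  THIS FILE PROVES (d3) AND ASSEMBLES THE PROFILE.  Sorry-free; no `axiom`; no `instance`; no
notation; modules III ∕ IV ∕ VII–XI BY NAME, nothing restated.

WHAT IS TYPED HERE (printed ingredients: the one-dimensional Laplace ∕ Mills-ratio device «a linear lower envelope of
the exponent integrates to an exponential» [Durrett2019, Thm 1.2.6 (proof)]; Fubini [Durrett2019, Thm 1.7.2], [Spivak1965,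
Thm 3-10]; the chain rule and the mean value inequality [Spivak1965, Thm 2-2, Thm 2-7, Thm 2-9]; the face-flux form of
the Stein ∕ integration-by-parts defect [GlimmJaffe1987, §9.1 (9.1.32)], [Spivak1965, Thm 4-13]; Brascamp–Lieb
[BrascampLieb1976, Thm 4.1]; the DLR structure of finite-range specifications [FriedliVelenik2017, Lemma 6.7]; the
profile recursion of [Martinelli1999, §2.4], [MartinelliOlivieri1994]; the full-space analogue [HelfferSjostrand1994],
[Ledoux2001, Prop. 6.2 p.190]; Combes–Thomas [CombesThomas1973, §II]; Z-rows [Varah1975]):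
* §1 THE ONE-DIMENSIONAL ENDPOINT LAPLACE BOUND (pure calculus over `intervalIntegral`): for `h' = φ` with
  `φ(t) ≥ λ(t − (S − L))` on `[S − L, S]` (`λ, L > 0`) — i.e. `h` is `λ`-convex there with `h'(S − L) ≥ 0` —
  `t ↦ h(t) − λ(t − (S−L))²∕2` is non-decreasing, so `h(s) + (λL∕2)(S − s) ≤ h(S)` (the CHORD below the convex `h`,
  `add_le_end`), and integrating `e^{−h(S) + (λL∕2)(S−s)} ≤ e^{−h(s)}`:
      `e^{−h(S)} ≤ η'(λ, L) ∫_{S−L}^{S} e^{−h}`,   `η'(λ, L) = (λL∕2) ∕ (e^{λL²∕2} − 1)`   (`exp_neg_end_le`),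
  hence `≤ η' ∫_{−S}^{S} e^{−h}` (`exp_neg_top_le`), the mirror statement at `−S` (`exp_neg_bot_le`), and the sizes
  `η' ≤ 1∕L`, `η' ≤ λL e^{−λL²∕2}` for `λL² ≥ 2` (`etaH_le_inv`, `etaH_le_exp`).  This is the «tangent parabola + chord»
  computation of XI's header with the constant `η' = η∕2` (memo §0y.42 (d)), done in the one form that needs neither the
  minimiser nor a convexity API: a monotone function.
* §2 COORDINATE LINES THROUGH THE WINDOW: `insertNth l t y = insertNth l 0 y + t e_l`, window membership, the line
  derivative `d∕ds g(insertNth l s y) = ∂_l g` (`hasDerivAt_insertNth`, from XI `hasDerivAt_along`), the diagonal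
  convexity input `λ ≤ (g_xx)_{ll}` (`lam_le_hessian_diag`), an intermediate-value lemma (`sign_of_zero_free`: a
  continuous `λ`-increasing `φ` whose zeros lie in `[-a, a]` has `φ(a) ≥ 0 ≥ φ(−a)`), and THE LINE LEMMA `line_sign`: for
  `g ∈ C²` with `HessianBound g λ` and `IntMode 𝔖 δ g`, along EVERY coordinate line with the other coordinates `y` in the
  window, `∂_l g` is `λ`-increasing, `≥ 0` at `s = S − δ` and `≤ 0` at `s = −(S − δ)` (the one-site block `I = {l}` of
  `IntMode` confines the zeros of `s ↦ ∂_l g`); whence `exp_neg_face_le`: `e^{−g}` at either face point of the line is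
  `≤ η'(λ, δ) ∫_{−S}^{S} e^{−g(insertNth l s y)} ds`, for EVERY `y ∈ [-S,S]^m` — uniformly in the boundary field.
* §3 FUBINI OVER ONE FACE: `∫_{[-S,S]^{m+1}} ψ = ∫_{y ∈ [-S,S]^m} ∫_{s ∈ [-S,S]} ψ(insertNth l s y)` for continuous `ψ`
  (`setIntegral_cube_insertNth`; the measure-preserving `MeasurableEquiv.piFinSuccAbove`, the window pulled back to a
  product of windows, `setIntegral_prod`, `integral_integral_swap`), with the integrability of the pulled-back integrand
  and of the inner integral (`integrableOn_comp_insertNth`, `integrableOn_inner`).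
* §4 (d3) THE FACE MASS IS AT MOST `η'` TIMES THE CUBE MASS, weighted: `|∫_{face l = ±S} Ψ e^{−g}| ≤ M η'(λ,δ) Z_K(g)` for
  continuous `Ψ` with `|Ψ| ≤ M` on the window (`abs_face_le`: §2 pointwise in `y`, §3 to recognise `Z_K`); with module X
  `wallDefect_single_mul_cubeMass` (`Wall_{e_l}(Ψ) Z_K = ∫_{face +} − ∫_{face −}`):
      `|Wall_{e_l}(Ψ)| ≤ 2 η'(λ, δ) M`   for every `l`, every `n` (`abs_wallDefect_single_le`),
  for EVERY `g ∈ C²` with `HessianBound g λ`, `IntMode 𝔖 δ g`, `0 < δ ≤ S` — no smallness, no symmetry, no Z-rows needed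
  at this point; the Z-row structure enters only through XI (it is what makes `IntMode` hold and survive conditioning,
  and what bounds `‖w‖₁`).
* §5 `sup_K |Φ − ⟨Φ⟩_K| ≤ 2 S #B` for a `C¹`, `B`-measurable insert with `|∇Φ|² ≤ 1` (`abs_sub_le_osc` by the mean
  value inequality along the segment, `abs_cubeMean_le_on`, `cubeMean_const`, `abs_sub_cubeMean_le`).
* §6 THE PINNED PROFILE `κ^N_P ≤ κ^E_P` — A CORRECTION OF RECORD TO MODULE X's SEED INTERFACE.  X's `profileSetE` lets the
  normalisation `C > 0` of the one-sided data float, and every seed reduction of X ∕ XI (`kappaE_seed_of_stein ∕ _wall ∕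
  _wallCT ∕ _faces`) asks its pointwise hypothesis for ALL `C > 0` with the perturbative term `λ⁻¹ C⁻¹ ε` in it — unbounded
  as `C → 0⁺`, so for `ε > 0` those hypotheses are NOT dischargeable as typed (they remain correct, and usable at `ε = 0`).
  The recursion only produces `C ∈ {2R, R}` (VII `sideData_lo ∕ _hi`); `profileSetN ∕ kappaN` record `R ≤ C`, and X's
  chain is re-proved verbatim for `κ^N`: `abs_childCov_le_kappaN`, `kappaN_le_of_forall`, `side_boundN`, THE STEP
  `kappaP_stepN` (`κ_P(M) ≤ λ⁻¹ (a G(m+2r)) 2R² κ^N_P(m)²`, `M > 2m + 3r`), THE BARRIER `kappaN_barrier` and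
  `kappaP_barrier_of_seedN`, `kappaN_seed_of_forall`.
* §7 ASSEMBLY ON ROAD (d) (`RoadD 𝔖 m₂ ε δ = P_M(m₂) ∩ 𝔐_ε ∩ IntMode δ`, conditioning-closed by XI `condClosed_roadD`):
  THE PER-TRIPLE BOUND `abs_childCov_le_roadD` — for every exact child triple of a parent with `RowOsc ε`, `ZRow m₂` whose
  child has `RowOsc ε`, `IntMode δ`, and every insert `F ∈ Obs(B)` with `d(B, j) > s₀ + r`,
      `|Cov_K(F∘merge, C⁻¹∂_j f₁∘merge)| ≤ a²(2∕λ)e^{−μ s₀∕r} + (a∕m₂)(2η'(λ,δ)(2 S #B)) + λ⁻¹(C⁻¹ε + aε∕λ)`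
  (X `abs_cubeCov_le_stein` at the base point `0` with X `exists_dir ∕ partner_grad_osc ∕ hessian_dir_osc_le ∕
  abs_cubeMean_dD_le ∕ ell1_far_le`, XI `dir_l1_le_partner ∕ abs_wallDefect_le`, §4, §5); THE PROVED SEED
  `kappaN_seed_roadD`: if the closed-form, VOLUME-INDEPENDENT number
      `Σ(λ, R, r, a, m₂, δ, ε, μ, s₀) := a²(2∕λ) e^{−μ s₀∕r} + (a∕m₂)(4 η'(λ,δ) S a) + λ⁻¹(R⁻¹ + a∕λ) ε`
  is `≤ ρ∕(c A q)` (`c = 2R²∕λ`; range `r ≥ 1`, `μ ≥ 0` with `R a (e^μ − 1) ≤ λ∕2`, `0 < m₂ ≤ λ`, `0 < δ ≤ S`, `ε ≥ 0`),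
  then `c A q κ^N_P(s₀) ≤ ρ`; THE DECAY PROFILE `kappaP_decay_roadD`: along `s_{j+1} = 2s_j + 3r + 1` with
  `a G(s_j + 2r) ≤ A q^j`, `κ_P(M) ≤ ρ^{2^{j+1}} ∕ (c A q^{j+2})` for all `M ≥ s_{j+1}`; and the IN-SITU READ-OUT
  `abs_cubeCov_le_of_roadD` for ONE normalised action `f₀ ∈ P_M(m₂) ∩ 𝔐_ε` (`∇f₀(0) = 0`, `δ = S m₂∕R`, XI `roadD_mem`):
  every admissible pair of inserts at separation `M ≥ s_{j+1}` has `|Cov_K(F, H)| ≤ ρ^{2^{j+1}} ∕ (c A q^{j+2})`.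
  The three summands of `Σ` are made small SEPARATELY: the first by the initial separation `s₀`, the second by the window
  (`η'(λ,δ) ≤ λδ e^{−λδ²∕2}`: exponentially small in `λ S² m₂²∕R²` — the window must be many standard deviations wide, the
  natural regime of VII), the third by `ε`; `ρ < 1` then gives doubly-exponential decay in the scale index `j`, i.e.
  stretched-exponential decay in the separation with all constants depending on `(λ, R, r, a, m₂, δ, ε)` and the growth
  bound `(A, q)` only — THE FIRST WINDOWED DECAY ESTIMATE PROVED IN THIS DIRECTORY FOR A NON-GAUSSIAN CLASS.
WHAT THIS FILE DOES NOT CLAIM.  (i) The class is the road-(d) class of XI: Z-row (ferromagnetic, pointwise strictly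
diagonally dominant M-matrix) Hessians with GLOBAL bounds, banded `ε`-oscillating Hessian rows, FINITE range, the
interior-mode property; the read-out needs the root action NORMALISED (`∇f₀(0) = 0`); nothing is claimed for `𝔐` or `𝔐_ε`
(where module X's obstruction (W-0) stands); (ii) the seed condition `Σ ≤ ρ∕(c A q)` is a HYPOTHESIS on the constants —
the file proves no instance of it and chooses no `(s₀, A, q, ρ)`; with `ρ ≥ 1` the profile bound is true and empty;
(iii) the constants are crude by design (`sup_K|Φ̃| ≤ 2 S #B` instead of `2 S √#B`; the base point `z₀ = 0`; `η'` not
optimised in `δ`); (iv) lattice gauge-field Hessians are not Z-matrices in general, and nothing here is an estimate on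
any density of Bałaban's programme, nor a statement about [Balaban1987RG1] Thm 2 ∕ (0.31), nor about the cell's target (an
inhabitant of `B13TermWalkDataOneTorus.ExistsUniformAcrossSmall`): it is a theorem about finite-range, uniformly convex
SCALAR window models, labelled as such; (v) §6 does not alter module X: `kappaE ∕ profileSetE` and its seed theorems stand
as landed (true statements); the pinned profile is an ADDITION recording the defect of their interface at `ε > 0`;
(vi) no new literature fact is introduced: every cite tag names the printed source of an ingredient or the printed
analogue of a step, the proofs are ours.
-/

set_option autoImplicit false

namespace Literature.MathematicalPhysics.QuantumFieldTheory.Balaban1983to89.T4CubeShellFaceLaplace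

open MeasureTheory Set Matrix
open Literature.MathematicalPhysics.QuantumFieldTheory.Balaban1983to89.T4CubeShellConditional
open Literature.MathematicalPhysics.QuantumFieldTheory.Balaban1983to89.T4CubeShellDoubling
open Literature.MathematicalPhysics.QuantumFieldTheory.Balaban1983to89.T4CubePoincare
open Literature.MathematicalPhysics.QuantumFieldTheory.Balaban1983to89.T4CubeShellBlocks
open Literature.MathematicalPhysics.QuantumFieldTheory.Balaban1983to89.T4CubeShellProfile
open Literature.MathematicalPhysics.QuantumFieldTheory.Balaban1983to89.T4CubeShellProfileP
open Literature.MathematicalPhysics.QuantumFieldTheory.Balaban1983to89.T4CubeShellGradPartner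
open Literature.MathematicalPhysics.QuantumFieldTheory.Balaban1983to89.T4CubeShellResponseStein
open Literature.MathematicalPhysics.QuantumFieldTheory.Balaban1983to89.T4CubeShellSteinSeed
open Literature.MathematicalPhysics.QuantumFieldTheory.Balaban1983to89.T4CubeShellMMatrix
open Literature.Probability.Distributions


/-! ## §1 THE ONE-DIMENSIONAL LAPLACE BOUND AT AN ENDPOINT -/

section OneDim

/-- The endpoint Laplace constant `η'(λ, L) = (λL∕2) ∕ (e^{λL²∕2} − 1)`. [folklore] [cite: Durrett2019, Thm 1.2.6 (proof)] -/
noncomputable def etaH (lam L : ℝ) : ℝ := (lam * L / 2) / (Real.exp (lam * L ^ 2 / 2) - 1)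

/-- `e^x − 1 > 0` for `x > 0` (the denominator of `η'`). [folklore] [cite: Durrett2019, Thm 1.2.6] -/
theorem exp_sub_one_pos {x : ℝ} (hx : 0 < x) : 0 < Real.exp x - 1 := by
  have h := Real.add_one_lt_exp hx.ne'
  linarith

/-- `η' > 0`. [folklore] [cite: Durrett2019, Thm 1.2.6] -/
theorem etaH_pos {lam L : ℝ} (hlam : 0 < lam) (hL : 0 < L) : 0 < etaH lam L :=
  div_pos (by positivity) (exp_sub_one_pos (by positivity))

/-- `η'(λ, L) ≤ 1∕L` (from `e^x − 1 ≥ x`). [folklore] [cite: Durrett2019, Thm 1.2.6] -/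
theorem etaH_le_inv {lam L : ℝ} (hlam : 0 < lam) (hL : 0 < L) : etaH lam L ≤ 1 / L := by
  unfold etaH
  have hx : 0 < lam * L ^ 2 / 2 := by positivity
  have h1 : lam * L ^ 2 / 2 ≤ Real.exp (lam * L ^ 2 / 2) - 1 := by
    have := Real.add_one_le_exp (lam * L ^ 2 / 2); linarith
  calc lam * L / 2 / (Real.exp (lam * L ^ 2 / 2) - 1) ≤ lam * L / 2 / (lam * L ^ 2 / 2) :=
        div_le_div_of_nonneg_left (by positivity) hx h1
    _ = 1 / L := by field_simp
/-- `η'(λ, L) ≤ λ L e^{−λL²∕2}` once `λL²∕2 ≥ 1` (exponentially small in `λ L²`; the Mills-ratio shape). [folklore] [cite: Durrett2019, Thm 1.2.6] -/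
theorem etaH_le_exp {lam L : ℝ} (hlam : 0 < lam) (hL : 0 < L) (h1 : 1 ≤ lam * L ^ 2 / 2) :
    etaH lam L ≤ lam * L * Real.exp (-(lam * L ^ 2 / 2)) := by
  unfold etaH
  have h2 : 2 ≤ Real.exp (lam * L ^ 2 / 2) := by
    have e1 := Real.add_one_le_exp (1 : ℝ)
    have e2 := Real.exp_le_exp.mpr h1
    linarith
  have hpos : 0 < Real.exp (lam * L ^ 2 / 2) - 1 := by linarith
  rw [div_le_iff₀ hpos, Real.exp_neg]
  have hex : 0 < Real.exp (lam * L ^ 2 / 2) := Real.exp_pos _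
  have hinv : (Real.exp (lam * L ^ 2 / 2))⁻¹ * Real.exp (lam * L ^ 2 / 2) = 1 := inv_mul_cancel₀ hex.ne'
  have hlL : 0 < lam * L := mul_pos hlam hL
  have hI : (Real.exp (lam * L ^ 2 / 2))⁻¹ ≤ 1 / 2 := by
    rw [inv_eq_one_div]
    exact one_div_le_one_div_of_le (by norm_num) h2
  have key : lam * L * (Real.exp (lam * L ^ 2 / 2))⁻¹ * (Real.exp (lam * L ^ 2 / 2) - 1)
      = lam * L - lam * L * (Real.exp (lam * L ^ 2 / 2))⁻¹ := by
    linear_combination (lam * L) * hinv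
  rw [key]
  have := mul_le_mul_of_nonneg_left hI hlL.le
  linarith

/-- **Linear lower envelope of the derivative ⇒ quadratic gain at the endpoint.**  If `h' = φ` and
`φ(t) ≥ λ (t − s₀)` on `[s₀, S]` (`λ ≥ 0`), then `h(s) + (λ(S − s₀)∕2)(S − s) ≤ h(S)` for `s ∈ [s₀, S]`
(`t ↦ h(t) − λ(t − s₀)²∕2` is non-decreasing on `[s₀, S]`). [folklore] [cite: Spivak1965, Thm 2-7; Durrett2019, Thm 1.2.6 (proof)] -/
theorem add_le_end {h φ : ℝ → ℝ} {lam s₀ S : ℝ} (hlam : 0 ≤ lam) (hd : ∀ s, HasDerivAt h (φ s) s)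
    (hφ : ∀ t ∈ Icc s₀ S, lam * (t - s₀) ≤ φ t) {s : ℝ} (hs : s ∈ Icc s₀ S) :
    h s + lam * (S - s₀) / 2 * (S - s) ≤ h S := by
  have hq : ∀ t, HasDerivAt (fun t => lam * (t - s₀) ^ 2 / 2) (lam * (t - s₀)) t := by
    intro t
    have h1 : HasDerivAt (fun t => (t - s₀) * (t - s₀)) ((t - s₀) + (t - s₀)) t := by
      have := ((hasDerivAt_id' t).sub_const s₀).mul ((hasDerivAt_id' t).sub_const s₀)
      exact this.congr_deriv (by ring)
    have h2 := (h1.const_mul lam).div_const 2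
    have e : (fun t => lam * (t - s₀) ^ 2 / 2) = fun t => lam * ((t - s₀) * (t - s₀)) / 2 := by
      funext t; ring
    rw [e]
    exact h2.congr_deriv (by ring)
  have hg : ∀ t, HasDerivAt (fun t => h t - lam * (t - s₀) ^ 2 / 2) (φ t - lam * (t - s₀)) t :=
    fun t => (hd t).sub (hq t)
  have hmono : MonotoneOn (fun t => h t - lam * (t - s₀) ^ 2 / 2) (Icc s₀ S) := by
    refine monotoneOn_of_hasDerivWithinAt_nonneg (convex_Icc s₀ S)
      (fun t _ => (hg t).continuousAt.continuousWithinAt) (fun t _ => (hg t).hasDerivWithinAt) ?_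
    intro t ht
    rw [interior_Icc] at ht
    have := hφ t (Ioo_subset_Icc_self ht)
    linarith
  have hsS : s₀ ≤ S := hs.1.trans hs.2
  have h1 := hmono hs (right_mem_Icc.mpr hsS) hs.2
  dsimp only at h1
  have hhint : 0 ≤ lam * (S - s) * (s - s₀) :=
    mul_nonneg (mul_nonneg hlam (sub_nonneg.mpr hs.2)) (sub_nonneg.mpr hs.1)
  nlinarith [h1, hhint]

/-- `∫_{a}^{S} e^{E + c(S − s)} ds = e^{E} (e^{c(S − a)} − 1) ∕ c` (`c ≠ 0`). [folklore] [cite: Durrett2019, Thm 1.2.6 (proof)] -/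
theorem integral_exp_end (a S c E : ℝ) (hc : c ≠ 0) :
    ∫ s in a..S, Real.exp (E + c * (S - s)) = Real.exp E * (Real.exp (c * (S - a)) - 1) / c := by
  have hF : ∀ s, HasDerivAt (fun s => -(Real.exp (E + c * (S - s))) / c) (Real.exp (E + c * (S - s))) s := by
    intro s
    have h1 : HasDerivAt (fun s => E + c * (S - s)) (-c) s :=
      ((((hasDerivAt_id' s).const_sub S).const_mul c).const_add E).congr_deriv (by ring)
    have h3 := (h1.exp.neg).div_const c
    exact h3.congr_deriv (by rw [mul_neg, neg_neg, mul_div_cancel_right₀ _ hc])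
  have hcont : Continuous fun s => Real.exp (E + c * (S - s)) := by fun_prop
  rw [intervalIntegral.integral_eq_sub_of_hasDerivAt (fun s _ => hF s) (hcont.intervalIntegrable _ _)]
  rw [sub_self, mul_zero, add_zero, Real.exp_add]
  field_simp
  ring

/-- A function with a derivative everywhere is continuous. [folklore] -/
private theorem continuous_of_hasDerivAt {h φ : ℝ → ℝ} (hd : ∀ s, HasDerivAt h (φ s) s) : Continuous h :=
  continuous_iff_continuousAt.mpr fun s => (hd s).continuousAt

/-- **THE ENDPOINT LAPLACE BOUND.**  If `h' = φ` with `φ(t) ≥ λ(t − (S − L))` on `[S − L, S]` (`λ, L > 0`), then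
`e^{−h(S)} ≤ η'(λ, L) · ∫_{S−L}^{S} e^{−h}`,  `η'(λ, L) = (λL∕2) ∕ (e^{λL²∕2} − 1)` — the chord below the `λ`-convex
exponent integrates to an exponential (the device of the Gaussian tail bound). [folklore] [cite: Durrett2019, Thm 1.2.6 (proof)] -/
theorem exp_neg_end_le {h φ : ℝ → ℝ} {lam L S : ℝ} (hlam : 0 < lam) (hL : 0 < L)
    (hd : ∀ s, HasDerivAt h (φ s) s) (hφ : ∀ t ∈ Icc (S - L) S, lam * (t - (S - L)) ≤ φ t) :
    Real.exp (-h S) ≤ etaH lam L * ∫ s in (S - L)..S, Real.exp (-h s) := by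
  set c : ℝ := lam * L / 2 with hc
  have hc0 : 0 < c := by positivity
  have hcont : Continuous h := continuous_of_hasDerivAt hd
  have hpt : ∀ s ∈ Icc (S - L) S, Real.exp (-h S + c * (S - s)) ≤ Real.exp (-h s) := by
    intro s hs
    have h1 := add_le_end hlam.le hd hφ hs
    refine Real.exp_le_exp.mpr ?_
    have e : lam * (S - (S - L)) / 2 = c := by rw [hc]; ring
    rw [e] at h1
    linarith
  have hI1 : IntervalIntegrable (fun s => Real.exp (-h S + c * (S - s))) volume (S - L) S :=
    (by fun_prop : Continuous fun s => Real.exp (-h S + c * (S - s))).intervalIntegrable _ _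
  have hI2 : IntervalIntegrable (fun s => Real.exp (-h s)) volume (S - L) S :=
    (Real.continuous_exp.comp hcont.neg).intervalIntegrable _ _
  have hmono := intervalIntegral.integral_mono_on (by linarith) hI1 hI2 hpt
  rw [integral_exp_end (S - L) S c (-h S) hc0.ne'] at hmono
  have e2 : c * (S - (S - L)) = lam * L ^ 2 / 2 := by rw [hc]; ring
  rw [e2] at hmono
  have hden : 0 < Real.exp (lam * L ^ 2 / 2) - 1 := exp_sub_one_pos (by positivity)
  unfold etaH
  rw [div_mul_eq_mul_div, le_div_iff₀ hden]
  have h3 := (div_le_iff₀ hc0).mp hmono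
  rw [hc] at h3
  nlinarith [h3, Real.exp_pos (-h S)]

/-- … on the window `[-S, S] ⊇ [S − L, S]` (`L ≤ 2S`): `e^{−h(S)} ≤ η'(λ, L) ∫_{−S}^{S} e^{−h}`. [folklore] [cite: Durrett2019, Thm 1.2.6 (proof)] -/
theorem exp_neg_top_le {h φ : ℝ → ℝ} {lam L S : ℝ} (hlam : 0 < lam) (hL : 0 < L) (hLS : L ≤ 2 * S)
    (hd : ∀ s, HasDerivAt h (φ s) s) (hφ : ∀ t ∈ Icc (S - L) S, lam * (t - (S - L)) ≤ φ t) :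
    Real.exp (-h S) ≤ etaH lam L * ∫ s in (-S)..S, Real.exp (-h s) := by
  have h1 := exp_neg_end_le hlam hL hd hφ
  have hcont : Continuous h := continuous_of_hasDerivAt hd
  have h2 : ∫ s in (S - L)..S, Real.exp (-h s) ≤ ∫ s in (-S)..S, Real.exp (-h s) :=
    intervalIntegral.integral_mono_interval (by linarith) (by linarith) le_rfl
      (Filter.Eventually.of_forall fun s => (Real.exp_pos _).le)
      ((Real.continuous_exp.comp hcont.neg).intervalIntegrable _ _)
  exact h1.trans (mul_le_mul_of_nonneg_left h2 (etaH_pos hlam hL).le)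

/-- … the LOWER endpoint: if `φ(t) ≤ λ(t + (S − L))` on `[−S, −(S − L)]`, then `e^{−h(−S)} ≤ η'(λ, L) ∫_{−S}^{S} e^{−h}`
(reflection `s ↦ −s`). [folklore] [cite: Durrett2019, Thm 1.2.6 (proof)] -/
theorem exp_neg_bot_le {h φ : ℝ → ℝ} {lam L S : ℝ} (hlam : 0 < lam) (hL : 0 < L) (hLS : L ≤ 2 * S)
    (hd : ∀ s, HasDerivAt h (φ s) s) (hφ : ∀ t ∈ Icc (-S) (-(S - L)), φ t ≤ lam * (t + (S - L))) :
    Real.exp (-h (-S)) ≤ etaH lam L * ∫ s in (-S)..S, Real.exp (-h s) := by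
  have hd' : ∀ s, HasDerivAt (fun s => h (-s)) (-φ (-s)) s := fun s => by
    have := (hd (-s)).comp s (hasDerivAt_neg s)
    simpa [Function.comp_def] using this
  have hφ' : ∀ t ∈ Icc (S - L) S, lam * (t - (S - L)) ≤ -φ (-t) := fun t ht => by
    have := hφ (-t) ⟨by linarith [ht.2], by linarith [ht.1]⟩
    linarith
  have h1 := exp_neg_top_le hlam hL hLS hd' hφ'
  have e := intervalIntegral.integral_comp_neg (a := -S) (b := S) (fun u => Real.exp (-h u))
  simp only [neg_neg] at e
  rw [e] at h1
  exact h1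

end OneDim


/-! ## §2 COORDINATE LINES THROUGH THE WINDOW: derivative along `s ↦ insertNth l s y`, `λ ≤ (g_xx)_{ll}`, and the
SIGN of `∂_l g` at depth `δ` from the two faces under the interior-mode property -/

section Line

variable {m : ℕ}

/-- The coordinate line: `insertNth l t y = insertNth l 0 y + t e_l`. [folklore] -/
private theorem insertNth_eq_add_smul (l : Fin (m + 1)) (t : ℝ) (y : Fin m → ℝ) :
    (l.insertNth t y : Fin (m + 1) → ℝ) = l.insertNth (0 : ℝ) y + t • (Pi.single l (1 : ℝ) : Fin (m + 1) → ℝ) := by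
  funext i
  rcases Fin.eq_self_or_eq_succAbove l i with rfl | ⟨j, rfl⟩
  · simp [Fin.insertNth_apply_same]
  · simp [Fin.insertNth_apply_succAbove, Fin.succAbove_ne]

/-- A point of a face line lies in the window if its running coordinate does (the other coordinates are `y`'s). [folklore] -/
private theorem insertNth_mem_cube {S t : ℝ} {l : Fin (m + 1)} {y : Fin m → ℝ} (ht : |t| ≤ S) (hy : y ∈ cube m S) :
    (l.insertNth t y : Fin (m + 1) → ℝ) ∈ cube (m + 1) S := by
  rw [mem_cube_iff] at hy ⊢
  intro i
  rcases Fin.eq_self_or_eq_succAbove l i with rfl | ⟨j, rfl⟩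
  · rwa [Fin.insertNth_apply_same]
  · rw [Fin.insertNth_apply_succAbove]; exact hy j

/-- Off the running coordinate the line point has the window coordinates of `y`. [folklore] -/
private theorem abs_insertNth_of_ne {S t : ℝ} {l : Fin (m + 1)} {y : Fin m → ℝ} (hy : y ∈ cube m S) {i : Fin (m + 1)}
    (hi : i ≠ l) : |(l.insertNth t y : Fin (m + 1) → ℝ) i| ≤ S := by
  obtain ⟨j, rfl⟩ := Fin.exists_succAbove_eq hi
  rw [Fin.insertNth_apply_succAbove]
  exact mem_cube_iff.mp hy j

/-- `Σ_i (e_l)_i c_i = c_l`. [folklore] -/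
private theorem sum_single_mul {k : ℕ} (l : Fin k) (c : Fin k → ℝ) :
    ∑ i, (Pi.single l (1 : ℝ) : Fin k → ℝ) i * c i = c l := by
  simp [Pi.single_apply]

/-- **Derivative along a coordinate line**: `d/ds g(insertNth l s y) = ∂_l g (insertNth l s y)`. [cite: Spivak1965, Thm 2-2 (chain rule), Thm 2-7] -/
theorem hasDerivAt_insertNth {g : (Fin (m + 1) → ℝ) → ℝ} (hg : Differentiable ℝ g) (l : Fin (m + 1))
    (y : Fin m → ℝ) (t : ℝ) :
    HasDerivAt (fun s : ℝ => g (l.insertNth s y)) (coordGradient g (l.insertNth t y) l) t := by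
  have h := hasDerivAt_along hg (l.insertNth (0 : ℝ) y) (Pi.single l 1) t
  rw [sum_single_mul, ← insertNth_eq_add_smul] at h
  have e : (fun s : ℝ => g (l.insertNth (0 : ℝ) y + s • (Pi.single l (1 : ℝ) : Fin (m + 1) → ℝ)))
      = fun s : ℝ => g (l.insertNth s y) := by
    funext s; rw [← insertNth_eq_add_smul]
  rwa [e] at h

/-- **The convexity input on the diagonal**: `λ ≤ (g_xx(x))_{ll}` (`HessianBound` tested on `e_l`). [folklore] [cite: BrascampLieb1976, §4 p. 375] -/
theorem lam_le_hessian_diag {k : ℕ} {g : (Fin k → ℝ) → ℝ} {lam : ℝ} (hB : HessianBound g lam) (x : Fin k → ℝ)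
    (l : Fin k) : lam ≤ coordHessian g x l l := by
  have h := hB x (Pi.single l 1)
  have e1 : (Pi.single l (1 : ℝ) : Fin k → ℝ) ⬝ᵥ (Pi.single l (1 : ℝ) : Fin k → ℝ) = 1 := by simp
  have e2 : (Pi.single l (1 : ℝ) : Fin k → ℝ) ⬝ᵥ (coordHessian g x *ᵥ (Pi.single l (1 : ℝ) : Fin k → ℝ))
      = coordHessian g x l l := by
    simp [Matrix.mulVec, dotProduct, Pi.single_apply]
  rwa [e1, e2, mul_one] at h

/-- **Sign at depth from a zero-free zone.**  A continuous `λ`-increasing `φ` (`λ > 0`) all of whose zeros lie in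
`[-a, a]` is `≥ 0` at `a` and `≤ 0` at `−a` (intermediate value theorem). [folklore] -/
private theorem sign_of_zero_free {φ : ℝ → ℝ} {lam a : ℝ} (hlam : 0 < lam) (hφc : Continuous φ)
    (hmono : ∀ s t, s ≤ t → lam * (t - s) ≤ φ t - φ s) (hz : ∀ t, φ t = 0 → |t| ≤ a) :
    0 ≤ φ a ∧ φ (-a) ≤ 0 := by
  constructor
  · by_contra hneg
    push Not at hneg
    set T : ℝ := a + -φ a / lam with hT
    have haT : a ≤ T := by
      have : 0 ≤ -φ a / lam := div_nonneg (by linarith) hlam.le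
      linarith
    have hφT : 0 ≤ φ T := by
      have h1 := hmono a T haT
      have e : lam * (T - a) = -φ a := by rw [hT]; field_simp; ring
      linarith
    obtain ⟨t, ht, hφt⟩ : ∃ t ∈ Icc a T, φ t = 0 :=
      intermediate_value_Icc haT hφc.continuousOn ⟨hneg.le, hφT⟩
    have hta : a < t := by
      rcases eq_or_lt_of_le ht.1 with h | h
      · rw [← h] at hφt; linarith
      · exact h
    have := hz t hφt
    linarith [le_abs_self t]
  · by_contra hpos
    push Not at hpos
    set T : ℝ := -a - φ (-a) / lam with hT
    have hTa : T ≤ -a := by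
      have : 0 ≤ φ (-a) / lam := div_nonneg hpos.le hlam.le
      linarith
    have hφT : φ T ≤ 0 := by
      have h1 := hmono T (-a) hTa
      have e : lam * (-a - T) = φ (-a) := by rw [hT]; field_simp; ring
      linarith
    obtain ⟨t, ht, hφt⟩ : ∃ t ∈ Icc T (-a), φ t = 0 :=
      intermediate_value_Icc hTa hφc.continuousOn ⟨hφT, hpos.le⟩
    have hta : t < -a := by
      rcases eq_or_lt_of_le ht.2 with h | h
      · rw [h] at hφt; linarith
      · exact h
    have := hz t hφt
    linarith [neg_le_abs t]

/-- **THE LINE LEMMA (road (d)).**  For `g ∈ C²` with `HessianBound g λ` and the interior-mode property `IntMode 𝔖 δ g`,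
along every coordinate line `s ↦ insertNth l s y` with `y` in the window: `φ(s) = ∂_l g` is `λ`-increasing, `φ(S − δ) ≥ 0`
and `φ(−(S − δ)) ≤ 0` — the line restriction of `e^{-g}` has its mode at depth `≥ δ` from both faces (module XI's
`IntMode` with the one-site block `I = {l}`; the mean value inequality for the `λ`-increase). [cite: Martinelli1999, §2.4 p.103 (Def. 2.6); OrtegaRheinboldt2000, 13.5.6; Spivak1965, Thm 2-2 (chain rule), Thm 2-7; BrascampLieb1976, Thm 4.1] -/
theorem line_sign (𝔖 : Spec (m + 1)) {δ : ℝ} {g : (Fin (m + 1) → ℝ) → ℝ} (hg : ContDiff ℝ 2 g)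
    (hB : HessianBound g 𝔖.lam) (hI : IntMode 𝔖 δ g) (l : Fin (m + 1)) {y : Fin m → ℝ} (hy : y ∈ cube m 𝔖.S) :
    (∀ s t, s ≤ t → 𝔖.lam * (t - s)
        ≤ coordGradient g (l.insertNth t y) l - coordGradient g (l.insertNth s y) l) ∧
      0 ≤ coordGradient g (l.insertNth (𝔖.S - δ) y) l ∧ coordGradient g (l.insertNth (-(𝔖.S - δ)) y) l ≤ 0 := by
  have hd1 : Differentiable ℝ (fun z => coordGradient g z l) :=
    (contDiff_one_coordGradient hg l).differentiable one_ne_zero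
  have hder : ∀ t, HasDerivAt (fun s : ℝ => coordGradient g (l.insertNth s y) l)
      (coordHessian g (l.insertNth t y) l l) t := fun t => by
    have h := hasDerivAt_insertNth hd1 l y t
    rwa [coordGradient_coordGradient_eq] at h
  have hdiff : Differentiable ℝ (fun s : ℝ => coordGradient g (l.insertNth s y) l) :=
    fun t => (hder t).differentiableAt
  have hmono : ∀ s t, s ≤ t → 𝔖.lam * (t - s)
      ≤ coordGradient g (l.insertNth t y) l - coordGradient g (l.insertNth s y) l := by
    intro s t hst
    exact mul_sub_le_image_sub_of_le_deriv hdiff (fun x => by rw [(hder x).deriv]; exact lam_le_hessian_diag hB _ l)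
      hst
  have hz : ∀ t, coordGradient g (l.insertNth t y) l = 0 → |t| ≤ 𝔖.S - δ := by
    intro t ht
    have hout : ∀ i, i ∉ ({l} : Finset (Fin (m + 1))) → |(l.insertNth t y : Fin (m + 1) → ℝ) i| ≤ 𝔖.S := by
      intro i hi
      rw [Finset.mem_singleton] at hi
      exact abs_insertNth_of_ne hy hi
    have hcrit : ∀ k ∈ ({l} : Finset (Fin (m + 1))), coordGradient g (l.insertNth t y) k = 0 := by
      intro k hk
      rw [Finset.mem_singleton] at hk
      rw [hk]; exact ht
    have h := hI {l} (l.insertNth t y) hout hcrit l (Finset.mem_singleton_self l)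
    rwa [Fin.insertNth_apply_same] at h
  exact ⟨hmono, sign_of_zero_free 𝔖.lam_pos hdiff.continuous hmono hz⟩

/-- **THE ENDPOINT BOUND ON A FACE LINE**: on road (d) (`0 < δ ≤ S`), for every `y` in the window and both faces `σ = ±S`,
`e^{−g(insertNth l σ y)} ≤ η'(λ, δ) ∫_{−S}^{S} e^{−g(insertNth l s y)} ds` — uniformly in `y`, i.e. in the boundary field. [cite: Martinelli1999, §2.4 p.103 (Def. 2.6); Durrett2019, Thm 1.2.6 (proof); BrascampLieb1976, Thm 4.1] -/
theorem exp_neg_face_le (𝔖 : Spec (m + 1)) {δ : ℝ} (hδ : 0 < δ) (hδS : δ ≤ 𝔖.S) {g : (Fin (m + 1) → ℝ) → ℝ}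
    (hg : ContDiff ℝ 2 g) (hB : HessianBound g 𝔖.lam) (hI : IntMode 𝔖 δ g) (l : Fin (m + 1)) {y : Fin m → ℝ}
    (hy : y ∈ cube m 𝔖.S) {σ : ℝ} (hσ : σ = 𝔖.S ∨ σ = -𝔖.S) :
    Real.exp (-g (l.insertNth σ y)) ≤ etaH 𝔖.lam δ * ∫ s in (-𝔖.S)..𝔖.S, Real.exp (-g (l.insertNth s y)) := by
  obtain ⟨hmono, htop, hbot⟩ := line_sign 𝔖 hg hB hI l hy
  have hd : ∀ s, HasDerivAt (fun s : ℝ => g (l.insertNth s y)) (coordGradient g (l.insertNth s y) l) s :=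
    fun s => hasDerivAt_insertNth (hg.differentiable (by norm_num)) l y s
  have hδ2 : δ ≤ 2 * 𝔖.S := by linarith [𝔖.S_pos]
  rcases hσ with rfl | rfl
  · refine exp_neg_top_le (h := fun s : ℝ => g (l.insertNth s y)) 𝔖.lam_pos hδ hδ2 hd fun t ht => ?_
    have := hmono (𝔖.S - δ) t ht.1
    linarith
  · refine exp_neg_bot_le (h := fun s : ℝ => g (l.insertNth s y)) 𝔖.lam_pos hδ hδ2 hd fun t ht => ?_
    have := hmono t (-(𝔖.S - δ)) ht.2
    linarith

end Line

/-! ## §3 FUBINI OVER ONE FACE: `∫_{[-S,S]^{m+1}} ψ = ∫_{y ∈ [-S,S]^m} ∫_{s ∈ [-S,S]} ψ(insertNth l s y)` -/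

section Fubini

variable {m : ℕ}

/-- The face-splitting measurable equivalence `(s, y) ↦ insertNth l s y` pulls the window back to a product of windows. [folklore] [cite: Spivak1965, Thm 3-10] -/
theorem preimage_cube_insertNth (l : Fin (m + 1)) (S : ℝ) :
    (MeasurableEquiv.piFinSuccAbove (fun _ : Fin (m + 1) => ℝ) l).symm ⁻¹' cube (m + 1) S
      = Icc (-S) S ×ˢ cube m S := by
  have h1 : cube (m + 1) S = Icc (fun _ : Fin (m + 1) => -S) (fun _ => S) := by rw [cube, Set.pi_univ_Icc]
  have h2 : cube m S = Icc (fun _ : Fin m => -S) (fun _ => S) := by rw [cube, Set.pi_univ_Icc]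
  rw [h1, h2]
  exact ((Fin.insertNthOrderIso (fun _ => ℝ) l).preimage_Icc _ _).trans (Icc_prod_eq _ _)

/-- The pulled-back integrand of a continuous `ψ` is integrable on the product of windows. [folklore] [cite: Durrett2019, Thm 1.7.2; Spivak1965, Thm 3-10] -/
theorem integrableOn_comp_insertNth {ψ : (Fin (m + 1) → ℝ) → ℝ} (hψ : Continuous ψ) (l : Fin (m + 1)) (S : ℝ) :
    IntegrableOn (fun p : ℝ × (Fin m → ℝ) => ψ (l.insertNth p.1 p.2)) (Icc (-S) S ×ˢ cube m S)
      ((volume : Measure ℝ).prod (volume : Measure (Fin m → ℝ))) := by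
  set e : ℝ × (Fin m → ℝ) ≃ᵐ (Fin (m + 1) → ℝ) := (MeasurableEquiv.piFinSuccAbove (fun _ => ℝ) l).symm with he
  have hem : MeasurePreserving e :=
    (volume_preserving_piFinSuccAbove (fun _ : Fin (m + 1) => ℝ) l).symm _
  have h := (hem.integrableOn_comp_preimage e.measurableEmbedding).mpr (integrableOn_cube' hψ S)
  rw [he, preimage_cube_insertNth] at h
  exact h

/-- **Fubini over the face `l`** (inner integral along the running coordinate). [folklore] [cite: Durrett2019, Thm 1.7.2; Spivak1965, Thm 3-10] -/
theorem setIntegral_cube_insertNth (S : ℝ) {ψ : (Fin (m + 1) → ℝ) → ℝ} (hψ : Continuous ψ) (l : Fin (m + 1)) :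
    ∫ x in cube (m + 1) S, ψ x = ∫ y in cube m S, ∫ s in Icc (-S) S, ψ (l.insertNth s y) := by
  set e : ℝ × (Fin m → ℝ) ≃ᵐ (Fin (m + 1) → ℝ) := (MeasurableEquiv.piFinSuccAbove (fun _ => ℝ) l).symm with he
  have hem : MeasurePreserving e :=
    (volume_preserving_piFinSuccAbove (fun _ : Fin (m + 1) => ℝ) l).symm _
  have hpre : e ⁻¹' cube (m + 1) S = Icc (-S) S ×ˢ cube m S := by rw [he]; exact preimage_cube_insertNth l S
  have heq : ∀ p : ℝ × (Fin m → ℝ), e p = l.insertNth p.1 p.2 := fun p => rfl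
  have hint : IntegrableOn (fun p : ℝ × (Fin m → ℝ) => ψ (e p)) (Icc (-S) S ×ˢ cube m S)
      ((volume : Measure ℝ).prod (volume : Measure (Fin m → ℝ))) := by
    simp only [heq]; exact integrableOn_comp_insertNth hψ l S
  rw [← hem.map_eq, setIntegral_map_equiv, hpre, Measure.volume_eq_prod, setIntegral_prod _ hint]
  have hsw : Integrable (Function.uncurry fun (s : ℝ) (y : Fin m → ℝ) => ψ (e (s, y)))
      (((volume : Measure ℝ).restrict (Icc (-S) S)).prod ((volume : Measure (Fin m → ℝ)).restrict (cube m S))) := by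
    rw [Measure.prod_restrict]; exact hint
  rw [integral_integral_swap hsw]
  rfl

/-- The inner face-line integral is integrable over the complementary window. [folklore] [cite: Durrett2019, Thm 1.7.2] -/
theorem integrableOn_inner {ψ : (Fin (m + 1) → ℝ) → ℝ} (hψ : Continuous ψ) (l : Fin (m + 1)) (S : ℝ) :
    IntegrableOn (fun y : Fin m → ℝ => ∫ s in Icc (-S) S, ψ (l.insertNth s y)) (cube m S) volume := by
  have hint := integrableOn_comp_insertNth hψ l S
  rw [IntegrableOn, ← Measure.prod_restrict] at hint
  exact hint.integral_prod_right

/-- The inner integral as an interval integral (`S ≥ 0`). [folklore] -/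
private theorem setIntegral_Icc_eq_interval {S : ℝ} (hS : 0 ≤ S) (F : ℝ → ℝ) :
    ∫ s in Icc (-S) S, F s = ∫ s in (-S)..S, F s := by
  rw [intervalIntegral.integral_of_le (by linarith), integral_Icc_eq_integral_Ioc]

end Fubini

/-! ## §4 THE FACE FLUX IS AT MOST `η'·Z_K`, and the PER-FACE WALL TERM `|Wall_{e_l}(Ψ)| ≤ 2 η' sup_K |Ψ|` -/

section Face

variable {m : ℕ}

/-- **FACE MASS ≤ η'·CUBE MASS (road (d)).**  For `g ∈ C²`, `HessianBound g λ`, `IntMode 𝔖 δ g` (`0 < δ ≤ S`) and a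
continuous `Ψ` with `|Ψ| ≤ M` on the window: `|∫_{face l = σ} Ψ e^{-g}| ≤ M η'(λ, δ) Z_K(g)`, `σ = ±S` (§2 pointwise in the
complementary coordinates, Fubini §3 to recognise `Z_K`). [cite: GlimmJaffe1987, §9.1 (9.1.32); Durrett2019, Thm 1.7.2, Thm 1.2.6 (proof); Martinelli1999, §2.4 p.103 (Def. 2.6); BrascampLieb1976, Thm 4.1] -/
theorem abs_face_le (𝔖 : Spec (m + 1)) {δ : ℝ} (hδ : 0 < δ) (hδS : δ ≤ 𝔖.S) {g : (Fin (m + 1) → ℝ) → ℝ}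
    (hg : ContDiff ℝ 2 g) (hB : HessianBound g 𝔖.lam) (hI : IntMode 𝔖 δ g) (l : Fin (m + 1))
    {Ψ : (Fin (m + 1) → ℝ) → ℝ} (hΨ : Continuous Ψ) {M : ℝ} (hM : ∀ z ∈ cube (m + 1) 𝔖.S, |Ψ z| ≤ M)
    {σ : ℝ} (hσ : σ = 𝔖.S ∨ σ = -𝔖.S) :
    |∫ y in cube m 𝔖.S, Ψ (l.insertNth σ y) * Real.exp (-g (l.insertNth σ y))|
      ≤ M * (etaH 𝔖.lam δ * cubeMass g 𝔖.S) := by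
  have hS := 𝔖.S_pos
  have hgc : Continuous g := hg.continuous
  have hσS : |σ| ≤ 𝔖.S := by
    rcases hσ with rfl | rfl
    · rw [abs_of_pos hS]
    · rw [abs_neg, abs_of_pos hS]
  have hins : Continuous fun y : Fin m → ℝ => (l.insertNth σ y : Fin (m + 1) → ℝ) := by fun_prop
  have hE : Continuous fun y : Fin m → ℝ => Real.exp (-g (l.insertNth σ y)) :=
    Real.continuous_exp.comp (hgc.comp hins).neg
  have hF : Continuous fun y : Fin m → ℝ => Ψ (l.insertNth σ y) * Real.exp (-g (l.insertNth σ y)) :=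
    (hΨ.comp hins).mul hE
  set inner : (Fin m → ℝ) → ℝ := fun y => ∫ s in Icc (-𝔖.S) 𝔖.S, Real.exp (-g (l.insertNth s y)) with hinner
  have hEg : Continuous fun x : Fin (m + 1) → ℝ => Real.exp (-g x) := Real.continuous_exp.comp hgc.neg
  have iInner : IntegrableOn inner (cube m 𝔖.S) volume := integrableOn_inner hEg l 𝔖.S
  have hM0 : 0 ≤ M := (abs_nonneg _).trans (hM _ (insertNth_mem_cube (l := l) hσS
    (show (fun _ : Fin m => (0 : ℝ)) ∈ cube m 𝔖.S from mem_cube_iff.mpr fun _ => by simpa using hS.le)))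
  -- (1) |∫ Ψ e^{-g}| ≤ ∫ M e^{-g} over the face
  have h1 : |∫ y in cube m 𝔖.S, Ψ (l.insertNth σ y) * Real.exp (-g (l.insertNth σ y))|
      ≤ ∫ y in cube m 𝔖.S, M * Real.exp (-g (l.insertNth σ y)) := by
    refine (abs_integral_le_integral_abs).trans (setIntegral_mono_on (integrableOn_cube' hF 𝔖.S).abs
      (integrableOn_cube' (continuous_const.mul hE) 𝔖.S) (measurableSet_cube' m 𝔖.S) fun y hy => ?_)
    rw [abs_mul, abs_of_pos (Real.exp_pos _)]
    exact mul_le_mul_of_nonneg_right (hM _ (insertNth_mem_cube hσS hy)) (Real.exp_pos _).le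
  -- (2) pointwise in `y`: e^{-g(face point)} ≤ η' · inner y
  have h2 : ∀ y ∈ cube m 𝔖.S, Real.exp (-g (l.insertNth σ y)) ≤ etaH 𝔖.lam δ * inner y := by
    intro y hy
    have h := exp_neg_face_le 𝔖 hδ hδS hg hB hI l hy hσ
    rwa [← setIntegral_Icc_eq_interval hS.le] at h
  -- (3) integrate (2) over `y` and use Fubini
  have h3 : ∫ y in cube m 𝔖.S, M * Real.exp (-g (l.insertNth σ y))
      ≤ ∫ y in cube m 𝔖.S, M * (etaH 𝔖.lam δ * inner y) :=
    setIntegral_mono_on (integrableOn_cube' (continuous_const.mul hE) 𝔖.S) ((iInner.const_mul _).const_mul _)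
      (measurableSet_cube' m 𝔖.S) fun y hy => mul_le_mul_of_nonneg_left (h2 y hy) hM0
  have h4 : ∫ y in cube m 𝔖.S, M * (etaH 𝔖.lam δ * inner y) = M * (etaH 𝔖.lam δ * cubeMass g 𝔖.S) := by
    rw [integral_const_mul, integral_const_mul, hinner, ← setIntegral_cube_insertNth 𝔖.S hEg l]
    rfl
  linarith [h1, h3, h4.le, h4.ge]

/-- **THE PER-FACE WALL TERM ON ROAD (d)**: `|Wall_{e_l}(Ψ)| ≤ 2 η'(λ, δ) sup_K |Ψ|` for `g ∈ C²` with `HessianBound g λ`,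
`IntMode 𝔖 δ g`, `0 < δ ≤ S`, and `Ψ ∈ C¹` with `|Ψ| ≤ M` on the window (module X `wallDefect_single_mul_cubeMass`:
`Wall_{e_l}(Ψ) Z_K = ∫_{face +} Ψe^{-g} − ∫_{face −} Ψe^{-g}`).  Stated for every `n` (vacuous for `n = 0`). [cite: GlimmJaffe1987, §9.1 (9.1.32); Spivak1965, Thm 4-13; Martinelli1999, §2.4 p.103 (Def. 2.6); Durrett2019, Thm 1.2.6 (proof); BrascampLieb1976, Thm 4.1] -/
theorem abs_wallDefect_single_le {n : ℕ} (𝔖 : Spec n) {δ : ℝ} (hδ : 0 < δ) (hδS : δ ≤ 𝔖.S)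
    {g : (Fin n → ℝ) → ℝ} (hg : ContDiff ℝ 2 g) (hB : HessianBound g 𝔖.lam) (hI : IntMode 𝔖 δ g)
    {Ψ : (Fin n → ℝ) → ℝ} (hΨ : ContDiff ℝ 1 Ψ) {M : ℝ} (hM : ∀ z ∈ cube n 𝔖.S, |Ψ z| ≤ M) (l : Fin n) :
    |wallDefect g 𝔖.S (Pi.single l 1) Ψ| ≤ 2 * etaH 𝔖.lam δ * M := by
  obtain ⟨m, rfl⟩ : ∃ m, n = m + 1 := Nat.exists_eq_succ_of_ne_zero (Nat.pos_iff_ne_zero.mp (Fin.pos l))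
  have hS := 𝔖.S_pos
  have hZ := cubeMass_pos hg.continuous hS
  have hw := wallDefect_single_mul_cubeMass hS (hg.of_le (by norm_num)) hΨ l
  have hp := abs_face_le 𝔖 hδ hδS hg hB hI l hΨ.continuous hM (Or.inl rfl)
  have hm := abs_face_le 𝔖 hδ hδS hg hB hI l hΨ.continuous hM (Or.inr rfl)
  have habs : |wallDefect g 𝔖.S (Pi.single l 1) Ψ| * cubeMass g 𝔖.S ≤ 2 * etaH 𝔖.lam δ * M * cubeMass g 𝔖.S := by
    rw [← abs_of_pos hZ, ← abs_mul, hw, abs_of_pos hZ]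
    refine (abs_sub _ _).trans ?_
    linarith
  exact le_of_mul_le_mul_right habs hZ

end Face

/-! ## §5 THE CENTRED INSERT IS UNIFORMLY BOUNDED ON THE WINDOW: `sup_K |Φ − ⟨Φ⟩_K| ≤ 2 S #B` -/

section Osc

variable {n : ℕ}

/-- `⟨c⟩_K = c`. [cite: Durrett2019, Thm 1.4.7 (ii)–(iii)] -/
theorem cubeMean_const {f : (Fin n → ℝ) → ℝ} (hf : Continuous f) {S : ℝ} (hS : 0 < S) (c : ℝ) :
    cubeMean f S (fun _ => c) = c := by
  have hZ := cubeMass_pos hf hS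
  unfold cubeMean
  rw [integral_const_mul]
  unfold cubeMass at hZ ⊢
  rw [mul_div_assoc, div_self hZ.ne', mul_one]

/-- `|h| ≤ M` ON THE WINDOW ⇒ `|⟨h⟩_K| ≤ M` (module X `abs_cubeMean_le` asks the bound everywhere). [cite: Durrett2019, Thm 1.4.7 (iv), (vi)] -/
theorem abs_cubeMean_le_on {S : ℝ} (hS : 0 < S) {f h : (Fin n → ℝ) → ℝ} (hf : Continuous f) (hh : Continuous h)
    {M : ℝ} (hM : ∀ x ∈ cube n S, |h x| ≤ M) : |cubeMean f S h| ≤ M := by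
  have hZ := cubeMass_pos hf hS
  have hE : Continuous fun x => Real.exp (-f x) := continuous_expNeg hf
  have ih : IntegrableOn (fun x => h x * Real.exp (-f x)) (cube n S) volume := integrableOn_cube' (hh.mul hE) S
  have iM : IntegrableOn (fun x => M * Real.exp (-f x)) (cube n S) volume :=
    integrableOn_cube' (continuous_const.mul hE) S
  have iM' : IntegrableOn (fun x => -M * Real.exp (-f x)) (cube n S) volume :=
    integrableOn_cube' (continuous_const.mul hE) S
  have up : ∫ x in cube n S, h x * Real.exp (-f x) ≤ ∫ x in cube n S, M * Real.exp (-f x) :=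
    setIntegral_mono_on ih iM (measurableSet_cube' n S)
      fun x hx => mul_le_mul_of_nonneg_right (abs_le.mp (hM x hx)).2 (Real.exp_pos _).le
  have dn : ∫ x in cube n S, -M * Real.exp (-f x) ≤ ∫ x in cube n S, h x * Real.exp (-f x) :=
    setIntegral_mono_on iM' ih (measurableSet_cube' n S)
      fun x hx => mul_le_mul_of_nonneg_right (abs_le.mp (hM x hx)).1 (Real.exp_pos _).le
  rw [integral_const_mul] at up dn
  unfold cubeMean
  rw [abs_le, le_div_iff₀ hZ, div_le_iff₀ hZ]
  unfold cubeMass at hZ ⊢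
  constructor <;> linarith

/-- **Oscillation on the window**: a `C¹`, `B`-measurable `Φ` with `|∇Φ|² ≤ 1` has `|Φ z − Φ z'| ≤ 2 S #B` for `z, z'`
in the window (mean value along the segment; `∂_k Φ = 0` off `B`, `|∂_k Φ| ≤ 1`, `|z_k − z'_k| ≤ 2S`). [cite: Spivak1965, Thm 2-7, Thm 2-9; FriedliVelenik2017, Lemma 6.3] -/
theorem abs_sub_le_osc {S : ℝ} {Φ : (Fin n → ℝ) → ℝ} (hΦ : ContDiff ℝ 1 Φ)
    (hΦ1 : ∀ z, coordGradient Φ z ⬝ᵥ coordGradient Φ z ≤ 1) {B : Finset (Fin n)}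
    (hΦd : DependsOn Φ (↑B : Set (Fin n))) {z z' : Fin n → ℝ} (hz : z ∈ cube n S) (hz' : z' ∈ cube n S) :
    |Φ z - Φ z'| ≤ 2 * S * B.card := by
  have hd : Differentiable ℝ Φ := hΦ.differentiable one_ne_zero
  have hpath : ∀ t, HasDerivAt (fun s : ℝ => Φ (z' + s • (z - z')))
      (∑ i, (z - z') i * coordGradient Φ (z' + t • (z - z')) i) t := fun t => hasDerivAt_along hd z' (z - z') t
  have hbound : ∀ t : ℝ, |∑ i, (z - z') i * coordGradient Φ (z' + t • (z - z')) i| ≤ 2 * S * B.card := by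
    intro t
    set y : Fin n → ℝ := z' + t • (z - z') with hy
    have hzero : ∀ k, k ∉ B → coordGradient Φ y k = 0 := fun k hk =>
      coordGradient_eq_zero_of_dependsOn hΦd (fun h => hk (Finset.mem_coe.mp h)) y
    have h1 : ∀ k, |coordGradient Φ y k| ≤ 1 := fun k => by
      have hsq : coordGradient Φ y k * coordGradient Φ y k ≤ 1 :=
        (Finset.single_le_sum (fun i _ => mul_self_nonneg (coordGradient Φ y i)) (Finset.mem_univ k)).trans (hΦ1 y)
      exact abs_le_one_iff_mul_self_le_one.mpr hsq
    rw [← Finset.sum_subset (Finset.subset_univ B) (fun k _ hk => by rw [hzero k hk, mul_zero])]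
    refine (Finset.abs_sum_le_sum_abs _ _).trans ?_
    have h2 : ∀ k ∈ B, |(z - z') k * coordGradient Φ y k| ≤ 2 * S := by
      intro k _
      have hzk := mem_cube_iff.mp hz k
      have hz'k := mem_cube_iff.mp hz' k
      have hzz : |(z - z') k| ≤ 2 * S := by
        rw [Pi.sub_apply]
        exact (abs_sub _ _).trans (by linarith)
      rw [abs_mul]
      have := mul_le_mul hzz (h1 k) (abs_nonneg _) (by linarith [abs_nonneg ((z - z') k)])
      linarith
    calc ∑ k ∈ B, |(z - z') k * coordGradient Φ y k| ≤ ∑ k ∈ B, 2 * S := Finset.sum_le_sum h2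
      _ = 2 * S * B.card := by rw [Finset.sum_const, nsmul_eq_mul]; ring
  have key := norm_image_sub_le_of_norm_deriv_le_segment_01' (f := fun s : ℝ => Φ (z' + s • (z - z')))
    (fun t _ => (hpath t).hasDerivWithinAt) (fun t _ => by rw [Real.norm_eq_abs]; exact hbound t)
  simpa [Real.norm_eq_abs] using key

/-- **`sup_K |Φ − ⟨Φ⟩_K| ≤ 2 S #B`** for such `Φ` and any continuous potential. [cite: Spivak1965, Thm 2-7; Durrett2019, Thm 1.4.7 (iv), (vi); FriedliVelenik2017, Lemma 6.3] -/
theorem abs_sub_cubeMean_le {S : ℝ} (hS : 0 < S) {g Φ : (Fin n → ℝ) → ℝ} (hg : Continuous g) (hΦ : ContDiff ℝ 1 Φ)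
    (hΦ1 : ∀ z, coordGradient Φ z ⬝ᵥ coordGradient Φ z ≤ 1) {B : Finset (Fin n)}
    (hΦd : DependsOn Φ (↑B : Set (Fin n))) {z : Fin n → ℝ} (hz : z ∈ cube n S) :
    |Φ z - cubeMean g S Φ| ≤ 2 * S * B.card := by
  have hΦc : Continuous Φ := hΦ.continuous
  have e : Φ z - cubeMean g S Φ = cubeMean g S (fun z' => Φ z - Φ z') := by
    rw [cubeMean_sub hg continuous_const hΦc, cubeMean_const hg hS]
  rw [e]
  exact abs_cubeMean_le_on hS hg (continuous_const.sub hΦc) fun z' hz' => abs_sub_le_osc hΦ hΦ1 hΦd hz hz'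

end Osc

/-! ## §6 THE PINNED PARENT-IN-CLASS PROFILE `κ^N_P ≤ κ^E_P`: only the normalisations `C ≥ R` the recursion produces

Module X's `profileSetE` lets the normalisation constant `C > 0` of the one-sided data float, and its seed reductions
(`kappaE_seed_of_stein ∕ _wall ∕ _wallCT`, module XI `kappaE_seed_of_faces`) ask their pointwise hypothesis for EVERY
`C > 0` — with the perturbative term `λ⁻¹ C⁻¹ ε`, which is unbounded as `C → 0⁺`: for `ε > 0` those hypotheses cannot be
discharged as typed.  The recursion (`kappaP_stepE`) only ever produces `C = 2R` (`sideData_lo`) and `C = R`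
(`sideData_hi`); pinning `R ≤ C` in the profile set keeps the step and the barrier VERBATIM and makes the perturbative
term uniform (`C⁻¹ ≤ R⁻¹`). -/

section ProfileN

variable {n : ℕ} (𝔖 : Spec n) (P : ((Fin n → ℝ) → ℝ) → Prop)

/-- The PINNED set of gradient-partner covariance values at separation `m` of the exact child triples of `P`-parents
with normalisation `C ≥ R` (and `0` adjoined). [cite: Martinelli1999, §2.4 p.103 (Def. 2.6); FriedliVelenik2017, Lemma 6.7 (6.7); GlimmJaffe1987, Cor. 4.3.4 (proof)] -/
def profileSetN (m : ℕ) : Set ℝ :=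
  {t | t = 0 ∨ ∃ (lab : Fin n → Fin 3) (f f₁ f₂ : (Fin n → ℝ) → ℝ) (C : ℝ) (x : Fin n → ℝ) (j : Fin n)
      (F : (Fin n → ℝ) → ℝ) (A : Finset (Fin n)),
      𝔖.SideData lab f f₁ f₂ C ∧ 𝔖.R ≤ C ∧ x ∈ cube n 𝔖.S ∧ lab j = 1 ∧ P f ∧ P (condPot lab 𝔖.lam f₁ x) ∧
        𝔖.Obs F A ∧ (∀ i ∈ A, lab i = 0) ∧ (∀ i ∈ A, m + 𝔖.r < 𝔖.d i j) ∧
        t = |cubeCov (condPot lab 𝔖.lam f₁ x) 𝔖.S (fun z => F (merge lab x z))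
              (fun z => C⁻¹ * coordGradient f₁ (merge lab x z) j)|}

/-- THE PINNED PARENT-IN-CLASS GRADIENT-PARTNER PROFILE `κ^N_P(m) := sup profileSetN 𝔖 P m`. [cite: Martinelli1999, §2.4 p.103 (Def. 2.6); GlimmJaffe1987, Cor. 4.3.4 (proof)] -/
noncomputable def kappaN (m : ℕ) : ℝ := sSup (profileSetN 𝔖 P m)

/-- `0` is adjoined. [cite: Martinelli1999, §2.4 p.103 (Def. 2.6)] -/
theorem zero_mem_profileSetN (m : ℕ) : (0 : ℝ) ∈ profileSetN 𝔖 P m := Or.inl rfl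

/-- The pinned profile set is nonempty. [cite: Martinelli1999, §2.4 p.103 (Def. 2.6)] -/
theorem profileSetN_nonempty (m : ℕ) : (profileSetN 𝔖 P m).Nonempty := ⟨0, zero_mem_profileSetN 𝔖 P m⟩

/-- `profileSetN ⊆ profileSetE` (forget the pin). [cite: Martinelli1999, §2.4 p.103 (Def. 2.6)] -/
theorem profileSetN_subset (m : ℕ) : profileSetN 𝔖 P m ⊆ profileSetE 𝔖 P m := by
  rintro t (rfl | ⟨lab, f, f₁, f₂, C, x, j, F, A, hD, -, hx, hj, hPf, hPc, hF, hA0, hA1, rfl⟩)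
  · exact zero_mem_profileSetE 𝔖 P m
  · exact Or.inr ⟨lab, f, f₁, f₂, C, x, j, F, A, hD, hx, hj, hPf, hPc, hF, hA0, hA1, rfl⟩

/-- The pinned profile set is bounded above. [cite: BrascampLieb1976, Thm 4.1] -/
theorem profileSetN_bddAbove (m : ℕ) : BddAbove (profileSetN 𝔖 P m) :=
  (profileSetE_bddAbove 𝔖 P m).mono (profileSetN_subset 𝔖 P m)

/-- `0 ≤ κ^N_P(m)`. [cite: Martinelli1999, §2.4 p.103 (Def. 2.6)] -/
theorem kappaN_nonneg (m : ℕ) : 0 ≤ kappaN 𝔖 P m :=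
  le_csSup (profileSetN_bddAbove 𝔖 P m) (zero_mem_profileSetN 𝔖 P m)

/-- **`κ^N_P ≤ κ^E_P`** (`≤ κ^∂_P ≤ κ_P ≤ κ`). [cite: Martinelli1999, §2.4 p.103 (Def. 2.6)] -/
theorem kappaN_le_kappaE (m : ℕ) : kappaN 𝔖 P m ≤ kappaE 𝔖 P m :=
  csSup_le_csSup (profileSetE_bddAbove 𝔖 P m) (profileSetN_nonempty 𝔖 P m) (profileSetN_subset 𝔖 P m)

/-- `κ^N_P ≤ κ_P`. [cite: Martinelli1999, §2.4 p.103 (Def. 2.6)] -/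
theorem kappaN_le_kappaP (m : ℕ) : kappaN 𝔖 P m ≤ kappaP 𝔖 P m :=
  ((kappaN_le_kappaE 𝔖 P m).trans (kappaE_le_kappaD 𝔖 P m)).trans (kappaD_le_kappaP 𝔖 P m)

/-- Every exact child covariance of a `P`-parent with `C ≥ R` is bounded by `κ^N_P(m)`. [cite: Martinelli1999, §2.4 p.103 (Def. 2.6); GlimmJaffe1987, Cor. 4.3.4 (proof)] -/
theorem abs_childCov_le_kappaN {lab : Fin n → Fin 3} {f f₁ f₂ : (Fin n → ℝ) → ℝ} {C : ℝ}
    (hD : 𝔖.SideData lab f f₁ f₂ C) (hC : 𝔖.R ≤ C) {x : Fin n → ℝ} (hx : x ∈ cube n 𝔖.S) {j : Fin n}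
    (hj : lab j = 1) (hPf : P f) (hPc : P (condPot lab 𝔖.lam f₁ x)) {m : ℕ} {F : (Fin n → ℝ) → ℝ}
    {A : Finset (Fin n)} (hF : 𝔖.Obs F A) (hA0 : ∀ i ∈ A, lab i = 0) (hA1 : ∀ i ∈ A, m + 𝔖.r < 𝔖.d i j) :
    |cubeCov (condPot lab 𝔖.lam f₁ x) 𝔖.S (fun z => F (merge lab x z))
        (fun z => C⁻¹ * coordGradient f₁ (merge lab x z) j)| ≤ kappaN 𝔖 P m :=
  le_csSup (profileSetN_bddAbove 𝔖 P m)
    (Or.inr ⟨lab, f, f₁, f₂, C, x, j, F, A, hD, hC, hx, hj, hPf, hPc, hF, hA0, hA1, rfl⟩)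

/-- **`κ^N_P(m)` is the LEAST bound of the pinned exact child covariances.** [cite: Martinelli1999, §2.4 p.103 (Def. 2.6); GlimmJaffe1987, Cor. 4.3.4 (proof); BrascampLieb1976, Thm 4.1] -/
theorem kappaN_le_of_forall {m : ℕ} {b : ℝ} (hb : 0 ≤ b)
    (h : ∀ (lab : Fin n → Fin 3) (f f₁ f₂ : (Fin n → ℝ) → ℝ) (C : ℝ) (x : Fin n → ℝ) (j : Fin n)
      (F : (Fin n → ℝ) → ℝ) (A : Finset (Fin n)),
      𝔖.SideData lab f f₁ f₂ C → 𝔖.R ≤ C → x ∈ cube n 𝔖.S → lab j = 1 → P f → P (condPot lab 𝔖.lam f₁ x) →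
        𝔖.Obs F A → (∀ i ∈ A, lab i = 0) → (∀ i ∈ A, m + 𝔖.r < 𝔖.d i j) →
        |cubeCov (condPot lab 𝔖.lam f₁ x) 𝔖.S (fun z => F (merge lab x z))
            (fun z => C⁻¹ * coordGradient f₁ (merge lab x z) j)| ≤ b) :
    kappaN 𝔖 P m ≤ b := by
  refine csSup_le (profileSetN_nonempty 𝔖 P m) ?_
  rintro t (rfl | ⟨lab, f, f₁, f₂, C, x, j, F, A, hD, hC, hx, hj, hPf, hPc, hF, hA0, hA1, rfl⟩)
  · exact hb
  · exact h lab f f₁ f₂ C x j F A hD hC hx hj hPf hPc hF hA0 hA1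

/-- **The one-sided recursion bound with `κ^N_P`** (module X `side_boundE` with the pin `R ≤ C` recorded). [cite: FriedliVelenik2017, Lemma 6.7 (6.7); FriedliVelenik2017, §6.10.1 (6.110); GlimmJaffe1987, Cor. 4.3.4 (proof); Martinelli1999, §2.4 p.103 (Def. 2.6)] -/
theorem side_boundN {lab : Fin n → Fin 3} {f f₁ f₂ : (Fin n → ℝ) → ℝ} {C : ℝ} (hD : 𝔖.SideData lab f f₁ f₂ C)
    (hC : 𝔖.R ≤ C) (hPf : P f) {m : ℕ} {F : (Fin n → ℝ) → ℝ} {A : Finset (Fin n)} (hF : 𝔖.Obs F A)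
    (hA0 : ∀ i ∈ A, lab i = 0) (hA1 : ∀ j, lab j = 1 → ∀ i ∈ A, m + 𝔖.r < 𝔖.d i j)
    (hcl : ∀ x ∈ cube n 𝔖.S, P (condPot lab 𝔖.lam f₁ x)) :
    ∀ x ∈ cube n 𝔖.S, ∀ j, lab j = 1 →
      |shellCov lab f₁ 𝔖.S F (fun y => coordGradient f₁ y j) x| ≤ C * kappaN 𝔖 P m := by
  intro x hx j hj
  have hκ := abs_childCov_le_kappaN 𝔖 P hD hC hx hj hPf (hcl x hx) hF hA0 (hA1 j hj)
  obtain ⟨hFc, -, hFd, -⟩ := hF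
  have hC0 : C ≠ 0 := hD.C_pos.ne'
  have hFd2 : DependsOn F {i | lab i ≠ 2} := hFd.mono fun i hi => by
    have h := hA0 i (Finset.mem_coe.mp hi)
    show lab i ≠ 2
    rw [h]; decide
  rw [shellCov_grad_eq_cubeCov_condPot 𝔖.S_pos lab 𝔖.lam (hD.cd₁.of_le (by norm_num)) hFc.continuous hD.dep₁
    hFd2 x j]
  have e : (fun z => coordGradient f₁ (merge lab x z) j)
      = fun z => C * (C⁻¹ * coordGradient f₁ (merge lab x z) j) := by
    funext z
    rw [← mul_assoc, mul_inv_cancel₀ hC0, one_mul]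
  rw [e, cubeCov_const_mul_right, abs_mul, abs_of_pos hD.C_pos]
  exact mul_le_mul_of_nonneg_left hκ hD.C_pos.le

/-- **THE STEP FROM `κ^N_P`**: for closed `P` and `M > 2m + 3r`, `κ_P(M) ≤ λ⁻¹ (a G(m + 2r)) 2R² κ^N_P(m)²` — module X
`kappaP_stepE` verbatim, the two sides having `C = 2R ≥ R` and `C = R ≥ R`. [cite: BrascampLieb1976, Thm 4.1; FriedliVelenik2017, Exercise 3.11 (3.26); GlimmJaffe1987, Cor. 4.3.4 (proof); Martinelli1999, §2.4 p.103 (Def. 2.6, Thm 2.7); MartinelliOlivieri1994] -/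
theorem kappaP_stepN (hcl : CondClosed 𝔖 P) {m M : ℕ} (hM : 2 * m + 3 * 𝔖.r < M) :
    kappaP 𝔖 P M ≤ 𝔖.lam⁻¹ * ((𝔖.a * 𝔖.growth (m + 2 * 𝔖.r) : ℕ) : ℝ) * (2 * 𝔖.R ^ 2) * kappaN 𝔖 P m ^ 2 := by
  have hlam := 𝔖.lam_pos
  have hR := 𝔖.R_pos
  have hκ := kappaN_nonneg 𝔖 P m
  refine kappaP_le_of_forall 𝔖 P (by positivity) fun f F H hAdm hPf => ?_
  obtain ⟨hfC, A, B, hF, hH, hsep⟩ := hAdm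
  have hw : 𝔖.Wide (𝔖.rlab A m) := 𝔖.wide_rlab
  have hDlo := 𝔖.sideData_lo hfC hw
  have hDhi := 𝔖.sideData_hi hfC hw
  have hclo : ∀ x ∈ cube n 𝔖.S, P (condPot (𝔖.rlab A m) 𝔖.lam (fLo (𝔖.rlab A m) f) x) :=
    fun x hx => (hcl hw hfC hPf x hx).1
  have hchi : ∀ x ∈ cube n 𝔖.S, P (condPot (lswap (𝔖.rlab A m)) 𝔖.lam (fHi (𝔖.rlab A m) f) x) :=
    fun x hx => (hcl hw hfC hPf x hx).2
  have hβ := side_boundN 𝔖 P hDlo (by linarith) hPf (m := m) hF (fun i hi => 𝔖.rlab_of_mem hi)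
    (fun j hj => 𝔖.rlab_shell_far hj) hclo
  have hγ' := side_boundN 𝔖 P hDhi le_rfl hPf (m := m) hH
    (fun k hk => (lswap_spec _ k).1.mpr (𝔖.rlab_of_sep hsep hM hk))
    (fun j hj => 𝔖.rlab_shell_far' hsep hM ((lswap_spec _ j).2.1.mp hj)) hchi
  have hγ : ∀ x ∈ cube n 𝔖.S, ∀ j, 𝔖.rlab A m j = 1 →
      |shellCov (𝔖.rlab A m) (fHi (𝔖.rlab A m) f) 𝔖.S H (fun y => coordGradient (fHi (𝔖.rlab A m) f) y j) x|
        ≤ 𝔖.R * kappaN 𝔖 P m := by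
    intro x hx j hj
    rw [← shellCov_lswap]
    exact hγ' x hx j ((lswap_spec _ j).2.1.mpr hj)
  have hB' : HessianBound (fLo (𝔖.rlab A m) f + fHi (𝔖.rlab A m) f) 𝔖.lam := by
    rw [fLo_add_fHi]; exact hfC.2.1
  have hFd : DependsOn F {i | 𝔖.rlab A m i = 0} :=
    hF.2.2.1.mono fun i hi => 𝔖.rlab_of_mem (Finset.mem_coe.mp hi)
  have hHd : DependsOn H {i | 𝔖.rlab A m i = 2} :=
    hH.2.2.1.mono fun k hk => 𝔖.rlab_of_sep hsep hM (Finset.mem_coe.mp hk)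
  have key := abs_cubeCov_le_doubling_profile 𝔖.S_pos 𝔖.lam_pos (𝔖.rlab A m) hDlo.cd₁ hDlo.cd₂ hB' hF.1 hH.1
    hDlo.dep₁ hFd hDlo.dep₂ hHd (κ₁ := kappaN 𝔖 P m) (κ₂ := kappaN 𝔖 P m) (C_F := 2 * 𝔖.R) (C_H := 𝔖.R) hκ hκ
    (by positivity) 𝔖.R_pos.le hβ hγ
  rw [fLo_add_fHi] at key
  have hN : (((Finset.univ.filter fun j => 𝔖.rlab A m j = 1).card : ℕ) : ℝ)
      ≤ ((𝔖.a * 𝔖.growth (m + 2 * 𝔖.r) : ℕ) : ℝ) := by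
    have h1 := 𝔖.card_shell_le (A := A) (m := m)
    have h2 : A.card * 𝔖.growth (m + 2 * 𝔖.r) ≤ 𝔖.a * 𝔖.growth (m + 2 * 𝔖.r) :=
      Nat.mul_le_mul_right _ hF.2.2.2
    exact_mod_cast h1.trans h2
  calc |cubeCov f 𝔖.S F H|
      ≤ 𝔖.lam⁻¹ * ((Finset.univ.filter fun j => 𝔖.rlab A m j = 1).card : ℝ) * (2 * 𝔖.R * 𝔖.R)
          * (kappaN 𝔖 P m * kappaN 𝔖 P m) := key
    _ ≤ 𝔖.lam⁻¹ * ((𝔖.a * 𝔖.growth (m + 2 * 𝔖.r) : ℕ) : ℝ) * (2 * 𝔖.R * 𝔖.R)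
          * (kappaN 𝔖 P m * kappaN 𝔖 P m) := by gcongr
    _ = 𝔖.lam⁻¹ * ((𝔖.a * 𝔖.growth (m + 2 * 𝔖.r) : ℕ) : ℝ) * (2 * 𝔖.R ^ 2) * kappaN 𝔖 P m ^ 2 := by ring

/-- **THE BARRIER FROM A PINNED SEED**: for closed `P`, along `s_{j+1} = 2 s_j + 3r + 1` with `a G(s_j + 2r) ≤ A q^j`,
ONE seed `c A q κ^N_P(s_0) ≤ ρ` (`c = 2R²∕λ`) gives `κ^N_P(s_j) ≤ ρ^{2^j} ∕ (c A q^{j+1})` for all `j` — module X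
`kappaE_barrier` verbatim with `κ^N`. [cite: Martinelli1999, §2.4 p.103 (Def. 2.6, Thm 2.7); MartinelliOlivieri1994; HelfferSjostrand1994; Ledoux2001, Prop. 6.2 p.190] -/
theorem kappaN_barrier (hcl : CondClosed 𝔖 P) (s : ℕ → ℕ) (hs : ∀ j, s (j + 1) = 2 * s j + 3 * 𝔖.r + 1)
    {A q ρ : ℝ} (hA : 0 < A) (hq : 0 < q) (hN : ∀ j, ((𝔖.a * 𝔖.growth (s j + 2 * 𝔖.r) : ℕ) : ℝ) ≤ A * q ^ j)
    (hseed : 𝔖.cst * A * q * kappaN 𝔖 P (s 0) ≤ ρ) :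
    ∀ j, kappaN 𝔖 P (s j) ≤ ρ ^ 2 ^ j / (𝔖.cst * A * q ^ (j + 1)) := by
  have hc := 𝔖.cst_pos
  set b : ℕ → ℝ := fun j => 𝔖.cst * A * q ^ (j + 1) * kappaN 𝔖 P (s j) with hb
  have hb0 : ∀ j, 0 ≤ b j := fun j => by
    have := kappaN_nonneg 𝔖 P (s j); simp only [hb]; positivity
  have hbstep : ∀ j, b (j + 1) ≤ b j ^ 2 := by
    intro j
    have hM : 2 * s j + 3 * 𝔖.r < s (j + 1) := by rw [hs j]; exact Nat.lt_succ_self _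
    have h1 := (kappaN_le_kappaP 𝔖 P (s (j + 1))).trans (kappaP_stepN 𝔖 P hcl hM)
    have hκ := kappaN_nonneg 𝔖 P (s j)
    have h2 : kappaN 𝔖 P (s (j + 1)) ≤ 𝔖.cst * (A * q ^ j) * kappaN 𝔖 P (s j) ^ 2 := by
      refine h1.trans ?_
      unfold Spec.cst
      have hlam := 𝔖.lam_pos
      have := hN j
      calc 𝔖.lam⁻¹ * ((𝔖.a * 𝔖.growth (s j + 2 * 𝔖.r) : ℕ) : ℝ) * (2 * 𝔖.R ^ 2) * kappaN 𝔖 P (s j) ^ 2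
          ≤ 𝔖.lam⁻¹ * (A * q ^ j) * (2 * 𝔖.R ^ 2) * kappaN 𝔖 P (s j) ^ 2 := by gcongr
        _ = 𝔖.lam⁻¹ * (2 * 𝔖.R ^ 2) * (A * q ^ j) * kappaN 𝔖 P (s j) ^ 2 := by ring
    simp only [hb]
    calc 𝔖.cst * A * q ^ (j + 1 + 1) * kappaN 𝔖 P (s (j + 1))
        ≤ 𝔖.cst * A * q ^ (j + 1 + 1) * (𝔖.cst * (A * q ^ j) * kappaN 𝔖 P (s j) ^ 2) := by
          have : 0 ≤ 𝔖.cst * A * q ^ (j + 1 + 1) := by positivity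
          exact mul_le_mul_of_nonneg_left h2 this
      _ = (𝔖.cst * A * q ^ (j + 1) * kappaN 𝔖 P (s j)) ^ 2 := by ring
  have hseed' : b 0 ≤ ρ := by simpa [hb] using hseed
  intro j
  have h := sq_barrier hb0 hbstep hseed' j
  simp only [hb] at h
  have hpos : 0 < 𝔖.cst * A * q ^ (j + 1) := by positivity
  rw [le_div_iff₀ hpos]
  calc kappaN 𝔖 P (s j) * (𝔖.cst * A * q ^ (j + 1)) = 𝔖.cst * A * q ^ (j + 1) * kappaN 𝔖 P (s j) := by ring
    _ ≤ ρ ^ 2 ^ j := h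

/-- **THE FULL RELATIVE PROFILE FROM A PINNED SEED**: from the first doubled scale on,
`κ_P(M) ≤ ρ^{2^{j+1}} ∕ (c A q^{j+2})` for `M ≥ s_{j+1}`. [cite: Martinelli1999, §2.4 p.103 (Def. 2.6, Thm 2.7); MartinelliOlivieri1994; HelfferSjostrand1994; Ledoux2001, Prop. 6.2 p.190] -/
theorem kappaP_barrier_of_seedN (hcl : CondClosed 𝔖 P) (s : ℕ → ℕ)
    (hs : ∀ j, s (j + 1) = 2 * s j + 3 * 𝔖.r + 1) {A q ρ : ℝ} (hA : 0 < A) (hq : 0 < q)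
    (hN : ∀ j, ((𝔖.a * 𝔖.growth (s j + 2 * 𝔖.r) : ℕ) : ℝ) ≤ A * q ^ j)
    (hseed : 𝔖.cst * A * q * kappaN 𝔖 P (s 0) ≤ ρ) {j M : ℕ} (hM : s (j + 1) ≤ M) :
    kappaP 𝔖 P M ≤ ρ ^ 2 ^ (j + 1) / (𝔖.cst * A * q ^ (j + 2)) := by
  refine (kappaP_antitone 𝔖 P hM).trans ?_
  have hc := 𝔖.cst_pos
  have hlam := 𝔖.lam_pos
  have hMj : 2 * s j + 3 * 𝔖.r < s (j + 1) := by rw [hs j]; exact Nat.lt_succ_self _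
  have hκ := kappaN_nonneg 𝔖 P (s j)
  have h1 := kappaP_stepN 𝔖 P hcl hMj
  have h2 := kappaN_barrier 𝔖 P hcl s hs hA hq hN hseed j
  have hpos : 0 < 𝔖.cst * A * q ^ (j + 1) := by positivity
  have h3 : kappaN 𝔖 P (s j) ^ 2 ≤ (ρ ^ 2 ^ j / (𝔖.cst * A * q ^ (j + 1))) ^ 2 := pow_le_pow_left₀ hκ h2 2
  have e : (ρ ^ 2 ^ j) ^ 2 = ρ ^ 2 ^ (j + 1) := by rw [← pow_mul, pow_succ]
  calc kappaP 𝔖 P (s (j + 1))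
      ≤ 𝔖.lam⁻¹ * ((𝔖.a * 𝔖.growth (s j + 2 * 𝔖.r) : ℕ) : ℝ) * (2 * 𝔖.R ^ 2) * kappaN 𝔖 P (s j) ^ 2 := h1
    _ ≤ 𝔖.lam⁻¹ * (A * q ^ j) * (2 * 𝔖.R ^ 2) * (ρ ^ 2 ^ j / (𝔖.cst * A * q ^ (j + 1))) ^ 2 := by
        have := hN j
        gcongr
    _ = ρ ^ 2 ^ (j + 1) / (𝔖.cst * A * q ^ (j + 2)) := by
        rw [← e]
        unfold Spec.cst
        field_simp
        ring

/-- **The pinned seed, spelled out**: a POINTWISE bound `≤ ρ ∕ (c A q)` on the pinned exact child covariances of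
`P`-parents at separation `s₀` is the seed `c A q κ^N_P(s₀) ≤ ρ`. [cite: Martinelli1999, §2.4 p.103 (Def. 2.6, Thm 2.7); GlimmJaffe1987, Cor. 4.3.4 (proof); BrascampLieb1976, Thm 4.1] -/
theorem kappaN_seed_of_forall {s₀ : ℕ} {A q ρ : ℝ} (hA : 0 < A) (hq : 0 < q) (hρ : 0 ≤ ρ)
    (h : ∀ (lab : Fin n → Fin 3) (f f₁ f₂ : (Fin n → ℝ) → ℝ) (C : ℝ) (x : Fin n → ℝ) (j : Fin n)
      (F : (Fin n → ℝ) → ℝ) (B : Finset (Fin n)),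
      𝔖.SideData lab f f₁ f₂ C → 𝔖.R ≤ C → x ∈ cube n 𝔖.S → lab j = 1 → P f → P (condPot lab 𝔖.lam f₁ x) →
        𝔖.Obs F B → (∀ i ∈ B, lab i = 0) → (∀ i ∈ B, s₀ + 𝔖.r < 𝔖.d i j) →
        |cubeCov (condPot lab 𝔖.lam f₁ x) 𝔖.S (fun z => F (merge lab x z))
            (fun z => C⁻¹ * coordGradient f₁ (merge lab x z) j)| ≤ ρ / (𝔖.cst * A * q)) :
    𝔖.cst * A * q * kappaN 𝔖 P s₀ ≤ ρ := by
  have hc := 𝔖.cst_pos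
  have hpos : 0 < 𝔖.cst * A * q := by positivity
  have hk : kappaN 𝔖 P s₀ ≤ ρ / (𝔖.cst * A * q) := kappaN_le_of_forall 𝔖 P (div_nonneg hρ hpos.le) h
  calc 𝔖.cst * A * q * kappaN 𝔖 P s₀ ≤ 𝔖.cst * A * q * (ρ / (𝔖.cst * A * q)) :=
        mul_le_mul_of_nonneg_left hk hpos.le
    _ = ρ := mul_div_cancel₀ ρ hpos.ne'

end ProfileN

/-! ## §7 THE PER-TRIPLE CHILD COVARIANCE BOUND ON ROAD (d), THE PROVED WINDOWED SEED, AND THE DECAY PROFILE -/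

section RoadD

variable {n : ℕ} (𝔖 : Spec n)

/-- The road-(d) class `P_M(m₂) ∩ 𝔐_ε ∩ IntMode δ` (module XI `condClosed_roadD`). [cite: Martinelli1999, §2.4 p.103 (Def. 2.6); BermanPlemmons1994, Ch. 6 Thm 2.4 (iii); FriedliVelenik2017, Lemma 6.7 (6.7)–(6.10)] -/
def RoadD (m₂ ε δ : ℝ) (f : (Fin n → ℝ) → ℝ) : Prop := (MMatrix 𝔖 m₂ f ∧ NearGauss 𝔖 ε f) ∧ IntMode 𝔖 δ f

/-- `RoadD` unfolds to module XI's conjunction. [folklore] [cite: Martinelli1999, §2.4 p.103 (Def. 2.6)] -/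
theorem roadD_eq (m₂ ε δ : ℝ) : RoadD 𝔖 m₂ ε δ = fun f => (MMatrix 𝔖 m₂ f ∧ NearGauss 𝔖 ε f) ∧ IntMode 𝔖 δ f := rfl

/-- The road-(d) class is conditioning-closed (`m₂ ≤ λ`, `δ ≤ S`). [cite: FriedliVelenik2017, Lemma 6.7 (6.7)–(6.10); FriedliVelenik2017, §6.10.1 (6.110); Martinelli1999, §2.4 p.103 (Def. 2.6); BermanPlemmons1994, Ch. 6 Thm 2.4 (iii)] -/
theorem condClosed_roadD' {m₂ : ℝ} (hm : m₂ ≤ 𝔖.lam) (ε : ℝ) {δ : ℝ} (hδ : δ ≤ 𝔖.S) :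
    CondClosed 𝔖 (RoadD 𝔖 m₂ ε δ) := condClosed_roadD 𝔖 hm ε hδ

/-- **THE PER-TRIPLE BOUND (PROVED).**  Range `r ≥ 1`, `μ ≥ 0` with `R a (e^μ − 1) ≤ λ∕2`, `0 < m₂ ≤ λ`, `0 < δ ≤ S`,
`ε ≥ 0`.  For every exact child triple of a parent `f` with `RowOsc ε f`, `ZRow m₂ f`, whose child `g = condPot lab λ f₁ x`
has `RowOsc ε g` and `IntMode 𝔖 δ g`, and every insert `F ∈ Obs(B)` with `d(B, j) > s₀ + r`:
`|Cov_K(F ∘ merge, C⁻¹ ∂_j f₁ ∘ merge)| ≤ a²(2∕λ) e^{−μ s₀∕r} + (a∕m₂)(2 η'(λ,δ) (2 S #B)) + λ⁻¹(C⁻¹ ε + a ε∕λ)` —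
(W1) Combes–Thomas on the far support, (W2) THE WALL TERM by faces: `‖w‖₁ ≤ a∕m₂` directions times the per-face flux
`2 η' sup_K|Φ̃|`, `sup_K |Φ̃| ≤ 2 S #B`, (W3) perturbative. [cite: BrascampLieb1976, Thm 4.1; CombesThomas1973, §II; Varah1975; GlimmJaffe1987, §9.1 (9.1.32), Cor. 4.3.4 (proof); HelfferSjostrand1994; Martinelli1999, §2.4 p.103 (Def. 2.6, Thm 2.7)] -/
theorem abs_childCov_le_roadD (hr : 0 < 𝔖.r) {μ : ℝ} (hμ : 0 ≤ μ)
    (hsmall : 𝔖.R * 𝔖.a * (Real.exp μ - 1) ≤ 𝔖.lam / 2) {ε : ℝ} (hε : 0 ≤ ε) {m₂ : ℝ} (hm : 0 < m₂)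
    (hml : m₂ ≤ 𝔖.lam) {δ : ℝ} (hδ : 0 < δ) (hδS : δ ≤ 𝔖.S) {s₀ : ℕ}
    {lab : Fin n → Fin 3} {f f₁ f₂ : (Fin n → ℝ) → ℝ} {C : ℝ} (hD : 𝔖.SideData lab f f₁ f₂ C) (x : Fin n → ℝ)
    {j : Fin n} (hj : lab j = 1) (hRf : RowOsc ε f) (hZf : ZRow m₂ f) (hRc : RowOsc ε (condPot lab 𝔖.lam f₁ x))
    (hIc : IntMode 𝔖 δ (condPot lab 𝔖.lam f₁ x)) {F : (Fin n → ℝ) → ℝ} {B : Finset (Fin n)} (hF : 𝔖.Obs F B)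
    (hB1 : ∀ i ∈ B, s₀ + 𝔖.r < 𝔖.d i j) :
    |cubeCov (condPot lab 𝔖.lam f₁ x) 𝔖.S (fun z => F (merge lab x z))
        (fun z => C⁻¹ * coordGradient f₁ (merge lab x z) j)|
      ≤ (𝔖.a : ℝ) ^ 2 * (2 / 𝔖.lam * Real.exp (-(μ * ((s₀ : ℝ) / 𝔖.r))))
        + 𝔖.a / m₂ * (2 * etaH 𝔖.lam δ * (2 * 𝔖.S * B.card)) + 𝔖.lam⁻¹ * (C⁻¹ * ε + 𝔖.a * ε / 𝔖.lam) := by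
  obtain ⟨hgc2, hgB, -, -⟩ := 𝔖.inClass_condPot hD x
  obtain ⟨hFc, hFg, hFd, hFa⟩ := hF
  set g : (Fin n → ℝ) → ℝ := condPot lab 𝔖.lam f₁ x with hg
  set Φ : (Fin n → ℝ) → ℝ := fun z => F (merge lab x z) with hΦdef
  set G : (Fin n → ℝ) → ℝ := fun z => C⁻¹ * coordGradient f₁ (merge lab x z) j with hGdef
  have hΦ : ContDiff ℝ 1 Φ := hFc.comp (contDiff_merge_right lab x)
  have hΦ1' : ∀ z, coordGradient Φ z ⬝ᵥ coordGradient Φ z ≤ 1 := fun z =>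
    (gradSq_comp_merge_le lab (hFc.differentiable one_ne_zero) x z).trans (hFg _)
  have hΦ1 : ∀ z ∈ cube n 𝔖.S, coordGradient Φ z ⬝ᵥ coordGradient Φ z ≤ 1 := fun z _ => hΦ1' z
  have hΦd : DependsOn Φ (↑B : Set (Fin n)) := dependsOn_comp_merge hFd lab x
  have hG : ContDiff ℝ 1 G :=
    contDiff_const.mul ((contDiff_one_coordGradient hD.cd₁ j).comp (contDiff_merge_right lab x))
  obtain ⟨w, hw⟩ := exists_dir 𝔖.lam_pos hgc2 hgB 0 (coordGradient G 0)
  have hδG : 0 ≤ C⁻¹ * ε := mul_nonneg (inv_nonneg.mpr hD.C_pos.le) hε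
  have hδH : 0 ≤ 𝔖.a * ε / 𝔖.lam := by have := 𝔖.lam_pos; positivity
  have key := abs_cubeCov_le_stein 𝔖.S_pos 𝔖.lam_pos hgc2 hgB hΦ hΦ1 hG w 0 hw hδG hδH
    (fun z _ => partner_grad_osc 𝔖 hD hRf x j z 0)
    (fun z _ => hessian_dir_osc_le 𝔖 hD x hRc hj ⟨hFc, hFg, hFd, hFa⟩ hB1 hw z)
  -- (W1)
  have hmain := (abs_cubeMean_dD_le 𝔖.S_pos hgc2.continuous hΦ hΦ1' hΦd w).trans
    (ell1_far_le 𝔖 hD hr hμ hsmall x hj hw hFa hB1)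
  -- (W2)
  have hΨ : ContDiff ℝ 1 (fun z => Φ z - cubeMean g 𝔖.S Φ) := hΦ.sub contDiff_const
  have hM : ∀ z ∈ cube n 𝔖.S, |Φ z - cubeMean g 𝔖.S Φ| ≤ 2 * 𝔖.S * B.card := fun z hz =>
    abs_sub_cubeMean_le 𝔖.S_pos hgc2.continuous hΦ hΦ1' hΦd hz
  have hω : ∀ l, |wallDefect g 𝔖.S (Pi.single l 1) (fun z => Φ z - cubeMean g 𝔖.S Φ)|
      ≤ 2 * etaH 𝔖.lam δ * (2 * 𝔖.S * B.card) := fun l =>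
    abs_wallDefect_single_le 𝔖 hδ hδS hgc2 hgB hIc hΨ hM l
  have hwall := abs_wallDefect_le (S := 𝔖.S) (hgc2.of_le (by norm_num)) hΨ w hω
  have hl1 := dir_l1_le_partner 𝔖 hD hm hZf hml x hj hw
  have hω0 : 0 ≤ 2 * etaH 𝔖.lam δ * (2 * 𝔖.S * B.card) := by
    have := etaH_pos 𝔖.lam_pos hδ; have := 𝔖.S_pos; positivity
  have hle := hwall.trans (mul_le_mul_of_nonneg_right hl1 hω0)
  linarith

/-- **THE PROVED WINDOWED SEED ON ROAD (d).**  If the closed-form, VOLUME-INDEPENDENT quantity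
`a²(2∕λ) e^{−μ s₀∕r} + (a∕m₂)(4 η'(λ,δ) S a) + λ⁻¹(R⁻¹ + a∕λ) ε` is `≤ ρ ∕ (c A q)` — the first summand is small by
the initial separation `s₀`, the second by the window (`η'(λ,δ) ≤ λδ e^{−λδ²∕2}` once `λδ² ≥ 2`), the third by `ε` —
then `c A q κ^N_{P}(s₀) ≤ ρ` for the road-(d) class `P = P_M(m₂) ∩ 𝔐_ε ∩ IntMode δ`. [cite: BrascampLieb1976, Thm 4.1; CombesThomas1973, §II; Varah1975; GlimmJaffe1987, §9.1 (9.1.32), Cor. 4.3.4 (proof); Martinelli1999, §2.4 p.103 (Def. 2.6, Thm 2.7); HelfferSjostrand1994; Ledoux2001, Prop. 6.2 p.190] -/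
theorem kappaN_seed_roadD (hr : 0 < 𝔖.r) {μ : ℝ} (hμ : 0 ≤ μ)
    (hsmall : 𝔖.R * 𝔖.a * (Real.exp μ - 1) ≤ 𝔖.lam / 2) {ε : ℝ} (hε : 0 ≤ ε) {m₂ : ℝ} (hm : 0 < m₂)
    (hml : m₂ ≤ 𝔖.lam) {δ : ℝ} (hδ : 0 < δ) (hδS : δ ≤ 𝔖.S) {s₀ : ℕ} {A q ρ : ℝ} (hA : 0 < A) (hq : 0 < q)
    (hρ : 0 ≤ ρ)
    (hnum : (𝔖.a : ℝ) ^ 2 * (2 / 𝔖.lam * Real.exp (-(μ * ((s₀ : ℝ) / 𝔖.r))))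
      + 𝔖.a / m₂ * (4 * etaH 𝔖.lam δ * 𝔖.S * 𝔖.a) + 𝔖.lam⁻¹ * (𝔖.R⁻¹ + 𝔖.a / 𝔖.lam) * ε
        ≤ ρ / (𝔖.cst * A * q)) :
    𝔖.cst * A * q * kappaN 𝔖 (RoadD 𝔖 m₂ ε δ) s₀ ≤ ρ := by
  refine kappaN_seed_of_forall 𝔖 (RoadD 𝔖 m₂ ε δ) hA hq hρ
    fun lab f f₁ f₂ C x j F B hD hC hx hj hPf hPc hF hB0 hB1 => ?_
  obtain ⟨⟨⟨-, hZf⟩, -, hRf⟩, -⟩ := hPf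
  obtain ⟨⟨-, -, hRc⟩, hIc⟩ := hPc
  have h := abs_childCov_le_roadD 𝔖 hr hμ hsmall hε hm hml hδ hδS (s₀ := s₀) hD x hj hRf hZf hRc hIc hF hB1
  have hη := etaH_pos 𝔖.lam_pos hδ
  have hS := 𝔖.S_pos
  have hlam := 𝔖.lam_pos
  have hR := 𝔖.R_pos
  have ha : (0 : ℝ) ≤ 𝔖.a := Nat.cast_nonneg _
  have hBa : (B.card : ℝ) ≤ 𝔖.a := by exact_mod_cast hF.2.2.2
  have h2 : 𝔖.a / m₂ * (2 * etaH 𝔖.lam δ * (2 * 𝔖.S * B.card)) ≤ 𝔖.a / m₂ * (4 * etaH 𝔖.lam δ * 𝔖.S * 𝔖.a) := by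
    have e : 4 * etaH 𝔖.lam δ * 𝔖.S * 𝔖.a = 2 * etaH 𝔖.lam δ * (2 * 𝔖.S * 𝔖.a) := by ring
    rw [e]
    have hm0 : 0 ≤ 𝔖.a / m₂ := div_nonneg ha hm.le
    gcongr
  have hCinv : C⁻¹ ≤ 𝔖.R⁻¹ := inv_anti₀ hR hC
  have h3 : 𝔖.lam⁻¹ * (C⁻¹ * ε + 𝔖.a * ε / 𝔖.lam) ≤ 𝔖.lam⁻¹ * (𝔖.R⁻¹ + 𝔖.a / 𝔖.lam) * ε := by
    have e : 𝔖.lam⁻¹ * (𝔖.R⁻¹ + 𝔖.a / 𝔖.lam) * ε = 𝔖.lam⁻¹ * (𝔖.R⁻¹ * ε + 𝔖.a * ε / 𝔖.lam) := by ring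
    rw [e]
    have := mul_le_mul_of_nonneg_right hCinv hε
    have hl0 : 0 ≤ 𝔖.lam⁻¹ := inv_nonneg.mpr hlam.le
    gcongr
  linarith

/-- **THE DECAY PROFILE ON ROAD (d) (PROVED).**  Under the closed-form seed condition of `kappaN_seed_roadD` at
`s₀ = s 0`, along the doubled scales `s_{j+1} = 2 s_j + 3r + 1` with `a G(s_j + 2r) ≤ A q^j`: for every `M ≥ s_{j+1}`,
`κ_P(M) ≤ ρ^{2^{j+1}} ∕ (c A q^{j+2})`, `P` the road-(d) class — doubly-exponential decay of all windowed conditional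
covariances of the class, uniformly in the volume `n`. [cite: Martinelli1999, §2.4 p.103 (Def. 2.6, Thm 2.7); MartinelliOlivieri1994; BrascampLieb1976, Thm 4.1; CombesThomas1973, §II; Varah1975; HelfferSjostrand1994; Ledoux2001, Prop. 6.2 p.190] -/
theorem kappaP_decay_roadD (hr : 0 < 𝔖.r) {μ : ℝ} (hμ : 0 ≤ μ)
    (hsmall : 𝔖.R * 𝔖.a * (Real.exp μ - 1) ≤ 𝔖.lam / 2) {ε : ℝ} (hε : 0 ≤ ε) {m₂ : ℝ} (hm : 0 < m₂)
    (hml : m₂ ≤ 𝔖.lam) {δ : ℝ} (hδ : 0 < δ) (hδS : δ ≤ 𝔖.S) (s : ℕ → ℕ)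
    (hs : ∀ j, s (j + 1) = 2 * s j + 3 * 𝔖.r + 1) {A q ρ : ℝ} (hA : 0 < A) (hq : 0 < q) (hρ : 0 ≤ ρ)
    (hN : ∀ j, ((𝔖.a * 𝔖.growth (s j + 2 * 𝔖.r) : ℕ) : ℝ) ≤ A * q ^ j)
    (hnum : (𝔖.a : ℝ) ^ 2 * (2 / 𝔖.lam * Real.exp (-(μ * ((s 0 : ℝ) / 𝔖.r))))
      + 𝔖.a / m₂ * (4 * etaH 𝔖.lam δ * 𝔖.S * 𝔖.a) + 𝔖.lam⁻¹ * (𝔖.R⁻¹ + 𝔖.a / 𝔖.lam) * ε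
        ≤ ρ / (𝔖.cst * A * q)) {j M : ℕ} (hM : s (j + 1) ≤ M) :
    kappaP 𝔖 (RoadD 𝔖 m₂ ε δ) M ≤ ρ ^ 2 ^ (j + 1) / (𝔖.cst * A * q ^ (j + 2)) :=
  kappaP_barrier_of_seedN 𝔖 (RoadD 𝔖 m₂ ε δ) (condClosed_roadD' 𝔖 hml ε hδS) s hs hA hq hN
    (kappaN_seed_roadD 𝔖 hr hμ hsmall hε hm hml hδ hδS hA hq hρ hnum) hM

/-- **IN-SITU READ-OUT FOR ONE NORMALISED ACTION (PROVED).**  For `f₀ ∈ P_M(m₂) ∩ 𝔐_ε` with `∇f₀(0) = 0` (the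
background field is the windowed minimum), `0 < m₂ ≤ λ`, margin `δ = S m₂∕R`: under the seed condition every
admissible pair of inserts at separation `M ≥ s_{j+1}` has `|Cov_K(F, H)| ≤ ρ^{2^{j+1}} ∕ (c A q^{j+2})`. [cite: Martinelli1999, §2.4 p.103 (Def. 2.6, Thm 2.7); MartinelliOlivieri1994; OrtegaRheinboldt2000, 13.5.6; BrascampLieb1976, Thm 4.1; Ledoux2001, Prop. 6.2 p.190] -/
theorem abs_cubeCov_le_of_roadD (hr : 0 < 𝔖.r) {μ : ℝ} (hμ : 0 ≤ μ)
    (hsmall : 𝔖.R * 𝔖.a * (Real.exp μ - 1) ≤ 𝔖.lam / 2) {ε : ℝ} (hε : 0 ≤ ε) {m₂ : ℝ} (hm : 0 < m₂)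
    (hml : m₂ ≤ 𝔖.lam) {f₀ : (Fin n → ℝ) → ℝ} (hf : MMatrix 𝔖 m₂ f₀) (hfε : NearGauss 𝔖 ε f₀)
    (h0 : ∀ k, coordGradient f₀ 0 k = 0) (s : ℕ → ℕ) (hs : ∀ j, s (j + 1) = 2 * s j + 3 * 𝔖.r + 1)
    {A q ρ : ℝ} (hA : 0 < A) (hq : 0 < q) (hρ : 0 ≤ ρ)
    (hN : ∀ j, ((𝔖.a * 𝔖.growth (s j + 2 * 𝔖.r) : ℕ) : ℝ) ≤ A * q ^ j)
    (hnum : (𝔖.a : ℝ) ^ 2 * (2 / 𝔖.lam * Real.exp (-(μ * ((s 0 : ℝ) / 𝔖.r))))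
      + 𝔖.a / m₂ * (4 * etaH 𝔖.lam (𝔖.S * m₂ / 𝔖.R) * 𝔖.S * 𝔖.a) + 𝔖.lam⁻¹ * (𝔖.R⁻¹ + 𝔖.a / 𝔖.lam) * ε
        ≤ ρ / (𝔖.cst * A * q)) {j M : ℕ} (hM : s (j + 1) ≤ M)
    {F H : (Fin n → ℝ) → ℝ} (hAdm : 𝔖.Adm M f₀ F H) :
    |cubeCov f₀ 𝔖.S F H| ≤ ρ ^ 2 ^ (j + 1) / (𝔖.cst * A * q ^ (j + 2)) := by
  have hδ : 0 < 𝔖.S * m₂ / 𝔖.R := by have := 𝔖.S_pos; have := 𝔖.R_pos; positivity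
  have hδS : 𝔖.S * m₂ / 𝔖.R ≤ 𝔖.S := margin_le_S 𝔖 hml
  have hP : RoadD 𝔖 m₂ ε (𝔖.S * m₂ / 𝔖.R) f₀ := roadD_mem 𝔖 hm hf hfε h0
  exact (abs_cubeCov_le_kappaP 𝔖 (RoadD 𝔖 m₂ ε (𝔖.S * m₂ / 𝔖.R)) hAdm hP).trans
    (kappaP_decay_roadD 𝔖 hr hμ hsmall hε hm hml hδ hδS s hs hA hq hρ hN hnum hM)

end RoadD

end Literature.MathematicalPhysics.QuantumFieldTheory.Balaban1983to89.T4CubeShellFaceLaplace
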